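import Mathlib
import Summits.ResolutionOfSingularities.ResolutionOfSingularities.Theses.RisoStrata

/-!
# Cotangent shadow — a complete proof of the crux `RtdLocal` (route RisoStrata, stmt-ResolutionOfSingularities-18840)

Crux idea `cotangent-shadow` (Cruxes/RtdLocal/Ideas/cotangent-shadow.md), carried to the end:
the final theorem `rtdLocal` of this file has type LITERALLY
`Summit.ResolutionOfSingularities.ResolutionOfSingularities.Theses.RisoStrata.RtdLocal`
(`lean check`: rc 0, 0 sorries, axioms propext / Classical.choice / Quot.sound; file audit:
`proof-of-item`, closed).

Mathematics (Monreal, arXiv:2606.12554, §3.2–§4.1, typed; characteristic-free):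
* `RtdSet c r` — clauses (1)(2)(3) of the route's inline `Rtd`, presentation stripped.
* point-set moves on `HahnSeries ℚ k`: `rtdSet_gl` (constant invertible matrices),
  `rtdSet_pad` / `rtdSet_collapse` (a STRICTLY DOMINATED block of coordinates is invisible —
  typed Lemma 3.21 + Prop 4.2), `rtdSet_reindex`, `rtdSet_perm`, `rtdSet_swap`, `shearMat`.
* algebra: `sq_dominated` (elements of `m²` are strictly dominated on arcs: 1-Lipschitz
  evaluation + strict product rule), `cotangent_congr` (mod `n²` every element of `n` is a
  `k`-combination of a presentation), `rtdSet_presentation` (presentation independence inside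
  one algebra = typed Prop 4.4), `resEquiv` (arcs of `B[s⁻¹]` at `m'` ≃ arcs of `B` at
  `m' ∩ B`, via `IsLocalization.Away`), `uEl_congr` (the one localisation congruence
  `s⁻¹ − c⁻¹ ≡ Σ μ_l g_l  mod m'²`), `nonempty_arc` (constant arc), `exists_presentation`.
* assembly `rtdLocal_main`: (⇒) presentation independence in `B[s⁻¹]` to the presentation
  `(g₀, u)`, shear, collapse the `u`-block, reindex along `resEquiv`; (⇐) reindex, pad with
  `u − Σ μ g`, shear, done.

Encoding facts discovered: Mathlib synthesises `Algebra k k((t^ℚ))` as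
`HahnSeries.powerSeriesAlgebra` (bridge `algebraMap_eq_C`, never `rfl`); `rtdSet_collapse` needs
`[Nonempty ι]` (false for empty ι); in clause (1) the witness `j` need not be the argmin.
Audit note for whoever lands this under Theorems/: `RtdSet`, `Dominated`, `RtdPres` are plain
auxiliary predicates (flagged `vendored-fact` = "untagged def : Prop" by the file audit); they
vendor nothing — inline them or move them per the gate's convention if it insists.
-/

namespace Summit.ResolutionOfSingularities.ResolutionOfSingularities.Cruxes.RtdLocal.CotangentShadow

open HahnSeries

variable {k : Type} [Field k]

/-- Clauses (1)(2)(3) of the route's inline `Rtd` for an abstract coordinate family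
`c : ι → (Fin n → k((t^ℚ)))` (ι = arcs, `c a = a ∘ g`): riso-trivial along `≥ r` constant
directions. -/
def RtdSet {ι : Type} {n : ℕ} (c : ι → Fin n → HahnSeries ℚ k) (r : ℕ) : Prop :=
  ∃ W : Submodule k (Fin n → k), r ≤ Module.finrank k W ∧
    ∃ φ : ι → (Fin n → HahnSeries ℚ k),
      (∀ a b : ι, a ≠ b → ∃ j, ∀ i,
          (c a j - c b j).orderTop < ((φ a i - φ b i) - (c a i - c b i)).orderTop) ∧
      (∀ a i, 0 < (φ a i).orderTop) ∧
      (∀ a, ∀ w : Fin n → HahnSeries ℚ k, (∀ i, 0 < (w i).orderTop) →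
          w ∈ Submodule.span (HahnSeries ℚ k)
            ((fun u : Fin n → k => fun i => HahnSeries.C (u i)) '' (W : Set (Fin n → k))) →
          ∃ b, φ b = φ a + w)

/-- Strict domination of a block `d` by a block `c` on the index set ι. -/
def Dominated {ι : Type} {n n' : ℕ} (c : ι → Fin n → HahnSeries ℚ k)
    (d : ι → Fin n' → HahnSeries ℚ k) : Prop :=
  ∀ a b : ι, a ≠ b → ∃ j, ∀ i, (c a j - c b j).orderTop < (d a i - d b i).orderTop

theorem orderTop_single_pos (x : k) {q : ℚ} (hq : 0 < q) :
    0 < (HahnSeries.single q x : HahnSeries ℚ k).orderTop := by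
  by_cases hx : x = 0
  · simp [hx]
  · rw [HahnSeries.orderTop_single hx]; exact_mod_cast hq

/-- The test vector `t • C u` lies in the span of the constant vectors of `W`. -/
theorem single_one_mem_span {N : ℕ} (W : Submodule k (Fin N → k)) {u : Fin N → k} (hu : u ∈ W) :
    (fun l => HahnSeries.single (1 : ℚ) (u l)) ∈
      Submodule.span (HahnSeries ℚ k)
        ((fun u : Fin N → k => fun i => HahnSeries.C (u i)) '' (W : Set (Fin N → k))) := by
  have hmem : (fun i => HahnSeries.C (u i) : Fin N → HahnSeries ℚ k) ∈
      Submodule.span (HahnSeries ℚ k)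
        ((fun u : Fin N → k => fun i => HahnSeries.C (u i)) '' (W : Set (Fin N → k))) :=
    Submodule.subset_span ⟨u, hu, rfl⟩
  have := Submodule.smul_mem _ (HahnSeries.single (1 : ℚ) (1 : k)) hmem
  convert this using 1
  funext l
  simp [Pi.smul_apply, smul_eq_mul, HahnSeries.single_mul_single]

/-- COLLAPSE / DOWN (typed Monreal Lemma 3.21 + Prop 4.2): a strictly dominated block of
coordinates can be dropped from a typed riso-triviality witness. `ι` must be inhabited
(ι = arcs ∋ the constant arc); for empty ι the statement is false (r ≤ n + n' vs r ≤ n). -/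
theorem rtdSet_collapse {ι : Type} [Nonempty ι] {n n' : ℕ} (c : ι → Fin n → HahnSeries ℚ k)
    (d : ι → Fin n' → HahnSeries ℚ k) (hdom : Dominated c d) (r : ℕ)
    (h : RtdSet (fun a => Fin.append (c a) (d a)) r) : RtdSet c r := by
  classical
  obtain ⟨a₀⟩ := ‹Nonempty ι›
  obtain ⟨W'', hr, φ'', h1, h2, h3⟩ := h
  -- the k-linear projection to the c-block and its Hahn-linear analogue
  let P : (Fin (n + n') → k) →ₗ[k] (Fin n → k) := LinearMap.funLeft k k (Fin.castAdd n')
  -- Step A: every vector of W'' has zero d-block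
  have hA : ∀ u ∈ W'', ∀ i : Fin n', u (Fin.natAdd n i) = 0 := by
    intro u hu i
    by_contra hui
    set w : Fin (n + n') → HahnSeries ℚ k := fun l => HahnSeries.single (1 : ℚ) (u l) with hw
    have hwpos : ∀ l, 0 < (w l).orderTop := fun l => orderTop_single_pos (u l) one_pos
    have hwspan := single_one_mem_span W'' hu
    obtain ⟨b, hb⟩ := h3 a₀ w hwpos hwspan
    by_cases hba : b = a₀
    · subst hba
      have hw0 : w = 0 := by simpa using hb.symm
      have : w (Fin.natAdd n i) = 0 := by simp [hw0]
      simp only [hw] at this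
      exact hui ((HahnSeries.single_eq_zero_iff).1 this)
    · obtain ⟨j'', hj''⟩ := h1 b a₀ hba
      obtain ⟨j₂, hj₂⟩ := hdom b a₀ hba
      -- differences and errors
      set Δ : Fin (n + n') → HahnSeries ℚ k :=
        fun l => Fin.append (c b) (d b) l - Fin.append (c a₀) (d a₀) l with hΔ
      have hE : ∀ l, w l = ((φ'' b l - φ'' a₀ l) - Δ l) + Δ l := by
        intro l; rw [hb]; simp [hΔ]
      have hΔc : ∀ j, Δ (Fin.castAdd n' j) = c b j - c a₀ j := by
        intro j; simp [hΔ, Fin.append_left]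
      have hΔd : ∀ i, Δ (Fin.natAdd n i) = d b i - d a₀ i := by
        intro i; simp [hΔ, Fin.append_right]
      have herr : ∀ l, (Δ j'').orderTop < ((φ'' b l - φ'' a₀ l) - Δ l).orderTop := by
        intro l
        have := hj'' l
        simpa [hΔ] using this
      -- minimum of the orderTops of Δ
      haveI : Nonempty (Fin (n + n')) := ⟨Fin.natAdd n i⟩
      obtain ⟨lm, -, hlm⟩ := Finset.exists_min_image Finset.univ (fun l => (Δ l).orderTop)
        Finset.univ_nonempty
      have hmin : ∀ l, (Δ lm).orderTop ≤ (Δ l).orderTop := fun l => hlm l (Finset.mem_univ l)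
      induction lm using Fin.addCases with
      | right im =>
        have h1' := hmin (Fin.castAdd n' j₂)
        rw [hΔd, hΔc] at h1'
        exact absurd (lt_of_le_of_lt h1' (hj₂ im)) (lt_irrefl _)
      | left jm =>
        -- ν := (Δ (castAdd jm)).orderTop is finite and equals 1
        have hν_le : (Δ (Fin.castAdd n' jm)).orderTop ≤ (c b j₂ - c a₀ j₂).orderTop := by
          simpa [hΔc] using hmin (Fin.castAdd n' j₂)
        have hν_lt_top : (Δ (Fin.castAdd n' jm)).orderTop < ⊤ :=
          lt_of_le_of_lt hν_le (lt_of_lt_of_le (hj₂ i) le_top)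
        -- at coordinate castAdd jm, w has orderTop ν
        have hwjm : (w (Fin.castAdd n' jm)).orderTop = (Δ (Fin.castAdd n' jm)).orderTop := by
          rw [hE (Fin.castAdd n' jm)]
          apply HahnSeries.orderTop_add_eq_right
          exact lt_of_le_of_lt (hmin j'') (herr _)
        -- hence ν = 1
        have hν1 : (Δ (Fin.castAdd n' jm)).orderTop = (1 : ℚ) := by
          rw [← hwjm]
          simp only [hw]
          by_cases hujm : u (Fin.castAdd n' jm) = 0
          · exfalso
            have : (w (Fin.castAdd n' jm)).orderTop = ⊤ := by simp [hw, hujm]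
            rw [hwjm] at this
            exact (ne_of_lt hν_lt_top) this
          · exact HahnSeries.orderTop_single hujm
        -- at coordinate natAdd i, w has orderTop 1 but also > 1
        have hwi : (w (Fin.natAdd n i)).orderTop = (1 : ℚ) := by
          simp only [hw]; exact HahnSeries.orderTop_single hui
        have hgt : (Δ (Fin.castAdd n' jm)).orderTop < (w (Fin.natAdd n i)).orderTop := by
          rw [hE (Fin.natAdd n i)]
          refine lt_of_lt_of_le (lt_min ?_ ?_) HahnSeries.min_orderTop_le_orderTop_add
          · exact lt_of_le_of_lt (hmin j'') (herr _)
          · rw [hΔd]; exact lt_of_le_of_lt hν_le (hj₂ i)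
        rw [hwi, hν1] at hgt
        exact lt_irrefl _ hgt
  -- Step B: the projected witness
  refine ⟨W''.map P, ?_, fun a j => φ'' a (Fin.castAdd n' j), ?_, ?_, ?_⟩
  · -- finrank preserved: P is injective on W''
    have hinj : Function.Injective (P.domRestrict W'') := by
      intro x y hxy
      apply Subtype.ext
      funext l
      induction l using Fin.addCases with
      | left j =>
        have := congrArg (fun v => v j) hxy
        simpa [P, LinearMap.funLeft_apply] using this
      | right i =>
        rw [hA _ x.2 i, hA _ y.2 i]
    have hrange : LinearMap.range (P.domRestrict W'') = W''.map P := by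
      rw [LinearMap.domRestrict, LinearMap.range_comp, Submodule.range_subtype]
    calc r ≤ Module.finrank k W'' := hr
      _ = Module.finrank k (LinearMap.range (P.domRestrict W'')) :=
          (LinearMap.finrank_range_of_inj hinj).symm
      _ = Module.finrank k (W''.map P) := by rw [hrange]
  · -- clause (1)
    intro a b hab
    obtain ⟨j'', hj''⟩ := h1 a b hab
    obtain ⟨j₂, hj₂⟩ := hdom a b hab
    induction j'' using Fin.addCases with
    | left j =>
      refine ⟨j, fun i => ?_⟩
      have := hj'' (Fin.castAdd n' i)
      simpa [Fin.append_left] using this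
    | right i₀ =>
      refine ⟨j₂, fun i => ?_⟩
      have := hj'' (Fin.castAdd n' i)
      simp only [Fin.append_left, Fin.append_right] at this
      exact lt_trans (hj₂ i₀) this
  · -- clause (2)
    intro a j; exact h2 a _
  · -- clause (3)
    intro a w hwpos hwspan
    -- the Hahn-linear projection
    let P' : (Fin (n + n') → HahnSeries ℚ k) →ₗ[HahnSeries ℚ k] (Fin n → HahnSeries ℚ k) :=
      LinearMap.funLeft (HahnSeries ℚ k) (HahnSeries ℚ k) (Fin.castAdd n')
    set S'' := Submodule.span (HahnSeries ℚ k)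
      ((fun u : Fin (n + n') → k => fun i => HahnSeries.C (u i)) '' (W'' : Set (Fin (n + n') → k)))
      with hS''
    have hS : Submodule.span (HahnSeries ℚ k)
        ((fun u : Fin n → k => fun i => HahnSeries.C (u i)) '' (W''.map P : Set (Fin n → k)))
        = S''.map P' := by
      rw [hS'', Submodule.map_span]
      congr 1
      ext v
      simp only [Set.mem_image, Submodule.map_coe, SetLike.mem_coe]
      constructor
      · rintro ⟨u, ⟨u', hu', rfl⟩, rfl⟩
        exact ⟨fun i => HahnSeries.C (u' i), ⟨u', hu', rfl⟩, rfl⟩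
      · rintro ⟨x, ⟨u', hu', rfl⟩, rfl⟩
        exact ⟨P u', ⟨u', hu', rfl⟩, rfl⟩
    rw [hS] at hwspan
    obtain ⟨x, hx, hxw⟩ := hwspan
    -- x has zero d-block
    have hxd : ∀ i, x (Fin.natAdd n i) = 0 := by
      intro i
      refine Submodule.span_induction (p := fun x _ => x (Fin.natAdd n i) = 0) ?_ ?_ ?_ ?_ hx
      · rintro _ ⟨u, hu, rfl⟩
        simp [hA u hu i]
      · simp
      · intro x y _ _ hx hy; simp [hx, hy]
      · intro s x _ hx; simp [hx]
    have hxeq : x = Fin.append w 0 := by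
      funext l
      induction l using Fin.addCases with
      | left j =>
        have := congrArg (fun v => v j) hxw
        simpa [P', LinearMap.funLeft_apply, Fin.append_left] using this.symm.symm
      | right i => simp [Fin.append_right, hxd i]
    have hxpos : ∀ l, 0 < (x l).orderTop := by
      intro l
      rw [hxeq]
      induction l using Fin.addCases with
      | left j => simpa [Fin.append_left] using hwpos j
      | right i => simp [Fin.append_right]
    obtain ⟨b, hb⟩ := h3 a x hxpos (by rw [hS'']; exact hx)
    refine ⟨b, ?_⟩
    funext j
    have := congrArg (fun v => v (Fin.castAdd n' j)) hb
    simp only [Pi.add_apply] at this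
    show φ'' b (Fin.castAdd n' j) = φ'' a (Fin.castAdd n' j) + w j
    rw [this, hxeq, Fin.append_left]

end Summit.ResolutionOfSingularities.ResolutionOfSingularities.Cruxes.RtdLocal.CotangentShadow

namespace Summit.ResolutionOfSingularities.ResolutionOfSingularities.Cruxes.RtdLocal.CotangentShadow

open HahnSeries

variable {k : Type} [Field k]

/-- Zero-padding `v ↦ (v, 0)` as a linear map (over any semiring of scalars acting on `X`). -/
def padLin (R X : Type) [Semiring R] [AddCommMonoid X] [Module R X] (n n' : ℕ) :
    (Fin n → X) →ₗ[R] (Fin (n + n') → X) where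
  toFun v := Fin.append v 0
  map_add' v w := by
    funext l
    induction l using Fin.addCases with
    | left j => simp [Fin.append_left]
    | right i => simp [Fin.append_right]
  map_smul' s v := by
    funext l
    induction l using Fin.addCases with
    | left j => simp [Fin.append_left]
    | right i => simp [Fin.append_right]

theorem padLin_apply {R X : Type} [Semiring R] [AddCommMonoid X] [Module R X] {n n' : ℕ}
    (v : Fin n → X) : padLin R X n n' v = Fin.append v 0 := rfl

theorem padLin_injective (R X : Type) [Semiring R] [AddCommMonoid X] [Module R X] (n n' : ℕ) :
    Function.Injective (padLin R X n n') := by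
  intro v w hvw
  funext j
  have := congrArg (fun f => f (Fin.castAdd n' j)) hvw
  simpa [padLin_apply, Fin.append_left] using this

/-- PAD / UP: a strictly dominated block can be added to a typed riso-triviality witness
(`φ ↦ (φ, 0)`, `W ↦ W × 0`). -/
theorem rtdSet_pad {ι : Type} {n n' : ℕ} (c : ι → Fin n → HahnSeries ℚ k)
    (d : ι → Fin n' → HahnSeries ℚ k) (hdom : Dominated c d) (r : ℕ)
    (h : RtdSet c r) : RtdSet (fun a => Fin.append (c a) (d a)) r := by
  classical
  obtain ⟨W, hr, φ, h1, h2, h3⟩ := h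
  let Q : (Fin n → k) →ₗ[k] (Fin (n + n') → k) := padLin k k n n'
  let Q' : (Fin n → HahnSeries ℚ k) →ₗ[HahnSeries ℚ k] (Fin (n + n') → HahnSeries ℚ k) :=
    padLin (HahnSeries ℚ k) (HahnSeries ℚ k) n n'
  refine ⟨W.map Q, ?_, fun a => Fin.append (φ a) 0, ?_, ?_, ?_⟩
  · -- finrank preserved
    rw [LinearEquiv.finrank_eq (Submodule.equivMapOfInjective Q (padLin_injective k k n n') W).symm]
    exact hr
  · -- clause (1): choose the better of the two indices
    intro a b hab
    obtain ⟨j, hj⟩ := h1 a b hab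
    obtain ⟨j₂, hj₂⟩ := hdom a b hab
    rcases le_total (c a j - c b j).orderTop (c a j₂ - c b j₂).orderTop with hle | hle
    · refine ⟨Fin.castAdd n' j, fun l => ?_⟩
      induction l using Fin.addCases with
      | left i => simpa [Fin.append_left] using hj i
      | right i =>
        simp only [Fin.append_left, Fin.append_right, Pi.zero_apply, sub_self, zero_sub, HahnSeries.orderTop_neg]
        exact lt_of_le_of_lt hle (hj₂ i)
    · refine ⟨Fin.castAdd n' j₂, fun l => ?_⟩
      induction l using Fin.addCases with
      | left i =>
        simp only [Fin.append_left]
        exact lt_of_le_of_lt hle (hj i)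
      | right i =>
        simp only [Fin.append_left, Fin.append_right, Pi.zero_apply, sub_self, zero_sub, HahnSeries.orderTop_neg]
        exact hj₂ i
  · -- clause (2)
    intro a l
    induction l using Fin.addCases with
    | left j => simpa [Fin.append_left] using h2 a j
    | right i => simp [Fin.append_right]
  · -- clause (3)
    intro a w' hw'pos hw'span
    set S := Submodule.span (HahnSeries ℚ k)
      ((fun u : Fin n → k => fun i => HahnSeries.C (u i)) '' (W : Set (Fin n → k))) with hSdef
    have hS' : Submodule.span (HahnSeries ℚ k)
        ((fun u : Fin (n + n') → k => fun i => HahnSeries.C (u i)) ''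
          (W.map Q : Set (Fin (n + n') → k))) = S.map Q' := by
      rw [hSdef, Submodule.map_span]
      congr 1
      ext v
      simp only [Set.mem_image, Submodule.map_coe, SetLike.mem_coe]
      constructor
      · rintro ⟨u, ⟨u', hu', rfl⟩, rfl⟩
        refine ⟨fun i => HahnSeries.C (u' i), ⟨u', hu', rfl⟩, ?_⟩
        funext l
        induction l using Fin.addCases with
        | left j => simp [Q, Q', padLin_apply, Fin.append_left]
        | right i => simp [Q, Q', padLin_apply, Fin.append_right]
      · rintro ⟨x, ⟨u', hu', rfl⟩, rfl⟩
        refine ⟨Q u', ⟨u', hu', rfl⟩, ?_⟩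
        funext l
        induction l using Fin.addCases with
        | left j => simp [Q, Q', padLin_apply, Fin.append_left]
        | right i => simp [Q, Q', padLin_apply, Fin.append_right]
    rw [hS'] at hw'span
    obtain ⟨x, hx, hxw⟩ := hw'span
    have hxpos : ∀ j, 0 < (x j).orderTop := by
      intro j
      have := hw'pos (Fin.castAdd n' j)
      rw [← hxw] at this
      simpa [Q', padLin_apply, Fin.append_left] using this
    obtain ⟨b, hb⟩ := h3 a x hxpos (by rw [hSdef]; exact hx)
    refine ⟨b, ?_⟩
    funext l
    rw [← hxw]
    induction l using Fin.addCases with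
    | left j => simp [hb, Q', padLin_apply, Fin.append_left]
    | right i => simp [Q', padLin_apply, Fin.append_right]

end Summit.ResolutionOfSingularities.ResolutionOfSingularities.Cruxes.RtdLocal.CotangentShadow

namespace Summit.ResolutionOfSingularities.ResolutionOfSingularities.Cruxes.RtdLocal.CotangentShadow

open HahnSeries

variable {k : Type} [Field k]

/-- orderTop of a finite sum is at least a common lower bound of the orderTops. -/
theorem le_orderTop_sum {N : ℕ} (s : Finset (Fin N)) (f : Fin N → HahnSeries ℚ k)
    (μ : WithTop ℚ) (hf : ∀ l ∈ s, μ ≤ (f l).orderTop) : μ ≤ (∑ l ∈ s, f l).orderTop := by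
  classical
  induction s using Finset.induction_on with
  | empty => simp
  | insert a s ha ih =>
    rw [Finset.sum_insert ha]
    exact le_trans (le_min (hf a (by simp)) (ih fun l hl => hf l (by simp [hl])))
      HahnSeries.min_orderTop_le_orderTop_add

theorem orderTop_C_nonneg (m : k) : (0 : WithTop ℚ) ≤ (HahnSeries.C m : HahnSeries ℚ k).orderTop := by
  by_cases hm : m = 0
  · simp [hm]
  · simp [HahnSeries.C_apply, HahnSeries.orderTop_single hm]

/-- Constant matrices do not decrease the min-valuation: every coordinate of `(N.map C) *ᵥ x`
has orderTop at least any common lower bound of the orderTops of `x`. -/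
theorem le_orderTop_mapC_mulVec {n : ℕ} (N : Matrix (Fin n) (Fin n) k)
    (x : Fin n → HahnSeries ℚ k) (μ : WithTop ℚ) (hx : ∀ l, μ ≤ (x l).orderTop) (i : Fin n) :
    μ ≤ (((N.map (HahnSeries.C : k →+* HahnSeries ℚ k)).mulVec x) i).orderTop := by
  classical
  simp only [Matrix.mulVec, dotProduct, Matrix.map_apply]
  apply le_orderTop_sum
  intro l _
  rw [HahnSeries.orderTop_mul]
  exact le_trans (hx l) (le_add_of_nonneg_left (orderTop_C_nonneg _))

theorem mapC_inv_mul {n : ℕ} (M : Matrix (Fin n) (Fin n) k) (hM : IsUnit M.det) :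
    (M⁻¹.map (HahnSeries.C : k →+* HahnSeries ℚ k)) * (M.map (HahnSeries.C : k →+* HahnSeries ℚ k))
      = 1 := by
  rw [← Matrix.map_mul, Matrix.nonsing_inv_mul _ hM]
  ext i j
  by_cases hij : i = j
  · subst hij; simp
  · simp [hij]

theorem mapC_mul_inv {n : ℕ} (M : Matrix (Fin n) (Fin n) k) (hM : IsUnit M.det) :
    (M.map (HahnSeries.C : k →+* HahnSeries ℚ k)) * (M⁻¹.map (HahnSeries.C : k →+* HahnSeries ℚ k))
      = 1 := by
  rw [← Matrix.map_mul, Matrix.mul_nonsing_inv _ hM]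
  ext i j
  by_cases hij : i = j
  · subst hij; simp
  · simp [hij]

theorem mapC_mulVec_C {n : ℕ} (M : Matrix (Fin n) (Fin n) k) (u : Fin n → k) :
    (M.map (HahnSeries.C : k →+* HahnSeries ℚ k)).mulVec (fun i => HahnSeries.C (u i)) =
      fun i => HahnSeries.C ((M.mulVec u) i) := by
  funext i
  simp [Matrix.mulVec, dotProduct, Matrix.map_apply, map_sum, map_mul]

/-- `GL_n(k)`-equivariance of typed riso-triviality: constant invertible matrices are
isometries of the min-valuation and conjugate straighteners (`W ↦ M W`, `φ ↦ M φ`). -/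
theorem rtdSet_gl {ι : Type} {n : ℕ} (c : ι → Fin n → HahnSeries ℚ k)
    (M : Matrix (Fin n) (Fin n) k) (hM : IsUnit M.det) (r : ℕ) (h : RtdSet c r) :
    RtdSet (fun a => (M.map (HahnSeries.C : k →+* HahnSeries ℚ k)).mulVec (c a)) r := by
  classical
  obtain ⟨W, hr, φ, h1, h2, h3⟩ := h
  set Mh := M.map (HahnSeries.C : k →+* HahnSeries ℚ k) with hMh
  set Mi := M⁻¹.map (HahnSeries.C : k →+* HahnSeries ℚ k) with hMi
  have hinv1 : Mi * Mh = 1 := mapC_inv_mul M hM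
  have hinv2 : Mh * Mi = 1 := mapC_mul_inv M hM
  have hback : ∀ x : Fin n → HahnSeries ℚ k, Mi.mulVec (Mh.mulVec x) = x := by
    intro x; rw [Matrix.mulVec_mulVec, hinv1, Matrix.one_mulVec]
  have hforth : ∀ x : Fin n → HahnSeries ℚ k, Mh.mulVec (Mi.mulVec x) = x := by
    intro x; rw [Matrix.mulVec_mulVec, hinv2, Matrix.one_mulVec]
  -- k-linear action on directions
  have hMinj : Function.Injective (Matrix.toLin' M) := by
    intro u v huv
    have : M⁻¹.mulVec (M.mulVec u) = M⁻¹.mulVec (M.mulVec v) := by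
      simp only [Matrix.toLin'_apply] at huv; rw [huv]
    simpa [Matrix.mulVec_mulVec, Matrix.nonsing_inv_mul _ hM] using this
  refine ⟨W.map (Matrix.toLin' M), ?_, fun a => Mh.mulVec (φ a), ?_, ?_, ?_⟩
  · rw [LinearEquiv.finrank_eq (Submodule.equivMapOfInjective _ hMinj W).symm]; exact hr
  · -- clause (1)
    intro a b hab
    obtain ⟨j, hj⟩ := h1 a b hab
    -- errors and differences
    set err : Fin n → HahnSeries ℚ k := fun i => (φ a i - φ b i) - (c a i - c b i) with herr
    set Δ' : Fin n → HahnSeries ℚ k := Mh.mulVec (c a - c b) with hΔ'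
    have hΔ'coord : ∀ l, Mh.mulVec (c a) l - Mh.mulVec (c b) l = Δ' l := by
      intro l; simp [hΔ', Matrix.mulVec_sub]
    have herr' : ∀ i, (Mh.mulVec (φ a) i - Mh.mulVec (φ b) i) -
        (Mh.mulVec (c a) i - Mh.mulVec (c b) i) = (Mh.mulVec err) i := by
      intro i
      simp only [herr]
      have : err = (φ a - φ b) - (c a - c b) := by funext i; simp [herr]
      rw [show (fun i => φ a i - φ b i - (c a i - c b i)) = (φ a - φ b) - (c a - c b) from by
        funext i; simp]
      simp [Matrix.mulVec_sub]
    -- minimum of the error orderTops is > v(Δc_j)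
    haveI : Nonempty (Fin n) := ⟨j⟩
    obtain ⟨l₀, -, hl₀⟩ := Finset.exists_min_image Finset.univ (fun l => (err l).orderTop)
      Finset.univ_nonempty
    have herr_lb : ∀ i, (err l₀).orderTop ≤ ((Mh.mulVec err) i).orderTop :=
      fun i => le_orderTop_mapC_mulVec M err _ (fun l => hl₀ l (Finset.mem_univ l)) i
    have hμ : (c a j - c b j).orderTop < (err l₀).orderTop := by
      have := hj l₀; simpa [herr] using this
    -- a coordinate of Δ' with orderTop ≤ v(Δc_j)
    obtain ⟨j', -, hj'⟩ := Finset.exists_min_image Finset.univ (fun l => (Δ' l).orderTop)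
      Finset.univ_nonempty
    have hΔle : (Δ' j').orderTop ≤ (c a j - c b j).orderTop := by
      have h' : (c a - c b) = Mi.mulVec Δ' := by rw [hΔ', hback]
      have : (c a j - c b j) = (Mi.mulVec Δ') j := by
        have := congrArg (fun v => v j) h'; simpa using this
      rw [this]
      exact le_orderTop_mapC_mulVec M⁻¹ Δ' _ (fun l => hj' l (Finset.mem_univ l)) j
    refine ⟨j', fun i => ?_⟩
    rw [hΔ'coord, herr']
    exact lt_of_le_of_lt hΔle (lt_of_lt_of_le hμ (herr_lb i))
  · -- clause (2)
    intro a i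
    haveI : Nonempty (Fin n) := ⟨i⟩
    obtain ⟨l₀, -, hl₀⟩ := Finset.exists_min_image Finset.univ (fun l => (φ a l).orderTop)
      Finset.univ_nonempty
    exact lt_of_lt_of_le (h2 a l₀)
      (le_orderTop_mapC_mulVec M (φ a) _ (fun l => hl₀ l (Finset.mem_univ l)) i)
  · -- clause (3)
    intro a w' hw'pos hw'span
    set S := Submodule.span (HahnSeries ℚ k)
      ((fun u : Fin n → k => fun i => HahnSeries.C (u i)) '' (W : Set (Fin n → k))) with hSdef
    have hS' : Submodule.span (HahnSeries ℚ k)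
        ((fun u : Fin n → k => fun i => HahnSeries.C (u i)) ''
          (W.map (Matrix.toLin' M) : Set (Fin n → k))) = S.map (Matrix.toLin' Mh) := by
      rw [hSdef, Submodule.map_span]
      congr 1
      ext v
      simp only [Set.mem_image, Submodule.map_coe, SetLike.mem_coe]
      constructor
      · rintro ⟨u, ⟨u', hu', rfl⟩, rfl⟩
        refine ⟨fun i => HahnSeries.C (u' i), ⟨u', hu', rfl⟩, ?_⟩
        rw [Matrix.toLin'_apply, Matrix.toLin'_apply, hMh, mapC_mulVec_C]
      · rintro ⟨x, ⟨u', hu', rfl⟩, rfl⟩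
        refine ⟨M.mulVec u', ⟨u', hu', rfl⟩, ?_⟩
        rw [Matrix.toLin'_apply, hMh, mapC_mulVec_C]
    rw [hS'] at hw'span
    obtain ⟨x, hx, hxw⟩ := hw'span
    rw [Matrix.toLin'_apply] at hxw
    have hxeq : x = Mi.mulVec w' := by rw [← hxw, hback]
    have hxpos : ∀ l, 0 < (x l).orderTop := by
      intro l
      haveI : Nonempty (Fin n) := ⟨l⟩
      obtain ⟨l₀, -, hl₀⟩ := Finset.exists_min_image Finset.univ (fun l => (w' l).orderTop)
        Finset.univ_nonempty
      rw [hxeq]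
      exact lt_of_lt_of_le (hw'pos l₀)
        (le_orderTop_mapC_mulVec M⁻¹ w' _ (fun l => hl₀ l (Finset.mem_univ l)) l)
    obtain ⟨b, hb⟩ := h3 a x hxpos (by rw [hSdef]; exact hx)
    refine ⟨b, ?_⟩
    show Mh.mulVec (φ b) = Mh.mulVec (φ a) + w'
    rw [hb, Matrix.mulVec_add, hxw]

end Summit.ResolutionOfSingularities.ResolutionOfSingularities.Cruxes.RtdLocal.CotangentShadow

namespace Summit.ResolutionOfSingularities.ResolutionOfSingularities.Cruxes.RtdLocal.CotangentShadow

open HahnSeries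

variable {k : Type} [Field k]

/-- Bridge for the `Algebra k k((t^ℚ))` instance Mathlib synthesises (`HahnSeries.powerSeriesAlgebra`,
through `PowerSeries k`): its `algebraMap` is still the constant embedding `HahnSeries.C`. -/
theorem algebraMap_eq_C (a : k) : algebraMap k (HahnSeries ℚ k) a = HahnSeries.C a := by
  rw [HahnSeries.algebraMap_apply', ← PowerSeries.C_eq_algebraMap, HahnSeries.ofPowerSeries_C]

/-- Evaluation of a polynomial with `k`-coefficients at `𝒪_K`-points is integral. -/
theorem orderTop_aeval_nonneg {N : ℕ} (P : MvPolynomial (Fin N) k) (y : Fin N → HahnSeries ℚ k)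
    (hy : ∀ l, 0 ≤ (y l).orderTop) : 0 ≤ (MvPolynomial.aeval y P).orderTop := by
  induction P using MvPolynomial.induction_on with
  | C a =>
    rw [MvPolynomial.aeval_C, algebraMap_eq_C]
    exact orderTop_C_nonneg (k := k) a
  | add p q hp hq =>
    rw [map_add]
    exact le_trans (le_min hp hq) HahnSeries.min_orderTop_le_orderTop_add
  | mul_X p l hp =>
    rw [map_mul, MvPolynomial.aeval_X, HahnSeries.orderTop_mul]
    exact add_nonneg hp (hy l)

/-- 1-Lipschitz evaluation: `v(P(y) − P(y′)) ≥ v(y − y′)` on `𝒪_K`-points. -/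
theorem le_orderTop_aeval_sub {N : ℕ} (P : MvPolynomial (Fin N) k) (y y' : Fin N → HahnSeries ℚ k)
    (hy : ∀ l, 0 ≤ (y l).orderTop) (hy' : ∀ l, 0 ≤ (y' l).orderTop) (μ : WithTop ℚ)
    (hμ : ∀ l, μ ≤ (y l - y' l).orderTop) :
    μ ≤ (MvPolynomial.aeval y P - MvPolynomial.aeval y' P).orderTop := by
  induction P using MvPolynomial.induction_on with
  | C a => simp
  | add p q hp hq =>
    rw [map_add, map_add, add_sub_add_comm]
    exact le_trans (le_min hp hq) HahnSeries.min_orderTop_le_orderTop_add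
  | mul_X p l hp =>
    rw [map_mul, map_mul, MvPolynomial.aeval_X, MvPolynomial.aeval_X]
    have : MvPolynomial.aeval y p * y l - MvPolynomial.aeval y' p * y' l =
        MvPolynomial.aeval y p * (y l - y' l) + (MvPolynomial.aeval y p - MvPolynomial.aeval y' p) * y' l := by
      ring
    rw [this]
    refine le_trans (le_min ?_ ?_) HahnSeries.min_orderTop_le_orderTop_add
    · rw [HahnSeries.orderTop_mul]
      exact le_add_of_nonneg_of_le (orderTop_aeval_nonneg p y hy) (hμ l)
    · rw [HahnSeries.orderTop_mul]
      exact le_add_of_le_of_nonneg hp (hy' l)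

theorem lt_add_of_pos_of_le_withTop {μ a b : WithTop ℚ} (hμ : μ ≠ ⊤) (ha : 0 < a) (hb : μ ≤ b) :
    μ < a + b := by
  induction a using WithTop.recTopCoe with
  | top => simpa [lt_top_iff_ne_top] using hμ
  | coe a' =>
    induction b using WithTop.recTopCoe with
    | top => simpa [lt_top_iff_ne_top] using hμ
    | coe b' =>
      lift μ to ℚ using hμ
      rw [← WithTop.coe_add]
      have ha' : (0 : ℚ) < a' := by exact_mod_cast ha
      have hb' : μ ≤ b' := by exact_mod_cast hb
      exact_mod_cast (by linarith : μ < a' + b')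

/-- Algebra-side input (the proof of Monreal Prop 4.2, typed): an element of `m²` is strictly
dominated, on arcs centred at `m`, by any presentation of `B` inside `m`. -/
theorem sq_dominated {K : Type} [Field K] [Algebra k K] (B : Subalgebra k K) (m : Ideal B)
    {N : ℕ} (h : Fin N → B) (hm : ∀ i, h i ∈ m)
    (hgen : Algebra.adjoin k (Set.range fun i => (h i : K)) = B)
    (q : B) (hq : q ∈ m ^ 2)
    (a b : {α : B →ₐ[k] HahnSeries ℚ k // ∀ x ∈ m, 0 < (α x).orderTop}) (hab : a ≠ b) :
    ∃ j, (a.1 (h j) - b.1 (h j)).orderTop < (a.1 q - b.1 q).orderTop := by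
  classical
  -- every element of B is a polynomial in h
  have hpoly : ∀ x : B, ∃ P : MvPolynomial (Fin N) k, MvPolynomial.aeval h P = x := by
    intro x
    have hx : (x : K) ∈ Algebra.adjoin k (Set.range fun i => (h i : K)) := by
      rw [hgen]; exact x.2
    rw [Algebra.adjoin_range_eq_range_aeval] at hx
    obtain ⟨P, hP⟩ := hx
    refine ⟨P, Subtype.ext ?_⟩
    have hc := congrArg (fun f => f P) (MvPolynomial.comp_aeval (f := h) B.val)
    simp only [AlgHom.comp_apply, Subalgebra.coe_val] at hc
    rw [hc]
    exact hP
  -- arcs evaluate polynomials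
  have heval : ∀ (α : B →ₐ[k] HahnSeries ℚ k) (P : MvPolynomial (Fin N) k),
      α (MvPolynomial.aeval h P) = MvPolynomial.aeval (fun i => α (h i)) P := by
    intro α P
    have := congrArg (fun f => f P) (MvPolynomial.comp_aeval (f := h) α)
    simpa using this
  -- two arcs agreeing on the presentation are equal
  have hext : (∀ l, a.1 (h l) = b.1 (h l)) → a = b := by
    intro hl
    apply Subtype.ext
    apply AlgHom.ext
    intro x
    obtain ⟨P, rfl⟩ := hpoly x
    rw [heval, heval]
    have : (fun i => a.1 (h i)) = (fun i => b.1 (h i)) := funext hl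
    rw [this]
  rcases isEmpty_or_nonempty (Fin N) with hN | hN
  · exact absurd (hext fun l => (hN.false l).elim) hab
  obtain ⟨j₀, -, hj₀⟩ := Finset.exists_min_image Finset.univ
    (fun l => (a.1 (h l) - b.1 (h l)).orderTop) Finset.univ_nonempty
  have hμle : ∀ l, (a.1 (h j₀) - b.1 (h j₀)).orderTop ≤ (a.1 (h l) - b.1 (h l)).orderTop :=
    fun l => hj₀ l (Finset.mem_univ l)
  -- the minimum is finite, else a = b
  have hμtop : (a.1 (h j₀) - b.1 (h j₀)).orderTop ≠ ⊤ := by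
    intro htop
    apply hab
    apply hext
    intro l
    have := hμle l
    rw [htop, top_le_iff, HahnSeries.orderTop_eq_top, sub_eq_zero] at this
    exact this
  have hpos : ∀ (α : {α : B →ₐ[k] HahnSeries ℚ k // ∀ x ∈ m, 0 < (α x).orderTop}) (l : Fin N),
      0 < (α.1 (h l)).orderTop := fun α l => α.2 _ (hm l)
  -- 1-Lipschitz on all of B
  have hlip : ∀ x : B, (a.1 (h j₀) - b.1 (h j₀)).orderTop ≤ (a.1 x - b.1 x).orderTop := by
    intro x
    obtain ⟨P, rfl⟩ := hpoly x
    rw [heval, heval]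
    exact le_orderTop_aeval_sub P _ _ (fun l => le_of_lt (hpos a l)) (fun l => le_of_lt (hpos b l))
      _ hμle
  refine ⟨j₀, ?_⟩
  rw [pow_two] at hq
  refine Submodule.mul_induction_on hq ?_ ?_
  · intro x hx y hy
    have : a.1 (x * y) - b.1 (x * y) = a.1 x * (a.1 y - b.1 y) + b.1 y * (a.1 x - b.1 x) := by
      rw [map_mul, map_mul]; ring
    rw [this]
    refine lt_of_lt_of_le (lt_min ?_ ?_) HahnSeries.min_orderTop_le_orderTop_add
    · rw [HahnSeries.orderTop_mul]
      exact lt_add_of_pos_of_le_withTop hμtop (a.2 x hx) (hlip y)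
    · rw [HahnSeries.orderTop_mul]
      exact lt_add_of_pos_of_le_withTop hμtop (b.2 y hy) (hlip x)
  · intro x y hx hy
    rw [map_add, map_add, add_sub_add_comm]
    exact lt_of_lt_of_le (lt_min hx hy) HahnSeries.min_orderTop_le_orderTop_add

end Summit.ResolutionOfSingularities.ResolutionOfSingularities.Cruxes.RtdLocal.CotangentShadow

/-! ## Reindexing, coordinate permutations, block swap -/

namespace Summit.ResolutionOfSingularities.ResolutionOfSingularities.Cruxes.RtdLocal.CotangentShadow

open HahnSeries

variable {k : Type} [Field k]

/-- Reindexing the arcs along a bijection. -/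
theorem rtdSet_reindex {ι ι' : Type} {n : ℕ} (c : ι → Fin n → HahnSeries ℚ k) (e : ι' ≃ ι) (r : ℕ)
    (h : RtdSet c r) : RtdSet (fun a' => c (e a')) r := by
  obtain ⟨W, hr, φ, h1, h2, h3⟩ := h
  refine ⟨W, hr, fun a' => φ (e a'), ?_, ?_, ?_⟩
  · intro a b hab; exact h1 (e a) (e b) (fun h => hab (e.injective h))
  · intro a i; exact h2 (e a) i
  · intro a w hw hws
    obtain ⟨b, hb⟩ := h3 (e a) w hw hws
    exact ⟨e.symm b, by simpa using hb⟩

/-- Permuting (or re-selecting along an equivalence) the coordinates. -/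
theorem rtdSet_perm {ι : Type} {n n' : ℕ} (c : ι → Fin n → HahnSeries ℚ k) (σ : Fin n' ≃ Fin n)
    (r : ℕ) (h : RtdSet c r) : RtdSet (fun a => fun i => c a (σ i)) r := by
  classical
  obtain ⟨W, hr, φ, h1, h2, h3⟩ := h
  let L : (Fin n → k) →ₗ[k] (Fin n' → k) := LinearMap.funLeft k k σ
  have hLinj : Function.Injective L := by
    intro u v huv; funext j
    have := congrArg (fun f => f (σ.symm j)) huv
    simpa [L, LinearMap.funLeft_apply] using this
  refine ⟨W.map L, ?_, fun a i => φ a (σ i), ?_, ?_, ?_⟩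
  · rw [LinearEquiv.finrank_eq (Submodule.equivMapOfInjective L hLinj W).symm]; exact hr
  · intro a b hab
    obtain ⟨j, hj⟩ := h1 a b hab
    exact ⟨σ.symm j, fun i => by simpa using hj (σ i)⟩
  · intro a i; exact h2 a (σ i)
  · intro a w hw hws
    set S := Submodule.span (HahnSeries ℚ k)
      ((fun u : Fin n → k => fun i => HahnSeries.C (u i)) '' (W : Set (Fin n → k))) with hS
    let L' : (Fin n → HahnSeries ℚ k) →ₗ[HahnSeries ℚ k] (Fin n' → HahnSeries ℚ k) :=
      LinearMap.funLeft _ _ σ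
    have hS' : Submodule.span (HahnSeries ℚ k)
        ((fun u : Fin n' → k => fun i => HahnSeries.C (u i)) '' (W.map L : Set (Fin n' → k)))
          = S.map L' := by
      rw [hS, Submodule.map_span]; congr 1; ext v
      simp only [Set.mem_image, Submodule.map_coe, SetLike.mem_coe]
      constructor
      · rintro ⟨u, ⟨u', hu', rfl⟩, rfl⟩; exact ⟨fun i => HahnSeries.C (u' i), ⟨u', hu', rfl⟩, rfl⟩
      · rintro ⟨x, ⟨u', hu', rfl⟩, rfl⟩; exact ⟨L u', ⟨u', hu', rfl⟩, rfl⟩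
    rw [hS'] at hws
    obtain ⟨x, hx, hxw⟩ := hws
    have hxw' : ∀ i, x (σ i) = w i := fun i => by
      have := congrArg (fun f => f i) hxw
      simpa [L', LinearMap.funLeft_apply] using this
    have hxpos : ∀ l, 0 < (x l).orderTop := by
      intro l; have := hw (σ.symm l); rw [← hxw'] at this; simpa using this
    obtain ⟨b, hb⟩ := h3 a x hxpos (by rw [hS]; exact hx)
    refine ⟨b, ?_⟩
    funext i
    have := congrArg (fun f => f (σ i)) hb
    simp only [Pi.add_apply] at this
    show φ b (σ i) = φ a (σ i) + w i
    rw [this, hxw']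

/-- The block swap `Fin (n' + n) ≃ Fin (n + n')`. -/
def swapEquiv (n n' : ℕ) : Fin (n' + n) ≃ Fin (n + n') :=
  finSumFinEquiv.symm.trans ((Equiv.sumComm (Fin n') (Fin n)).trans finSumFinEquiv)

theorem append_swapEquiv {X : Type} {n n' : ℕ} (x : Fin n → X) (y : Fin n' → X) :
    (fun i => Fin.append x y (swapEquiv n n' i)) = Fin.append y x := by
  funext l
  induction l using Fin.addCases with
  | left j => simp [swapEquiv, Fin.append_left, Fin.append_right]
  | right j => simp [swapEquiv, Fin.append_left, Fin.append_right]

theorem rtdSet_swap {ι : Type} {n n' : ℕ} (c : ι → Fin n → HahnSeries ℚ k)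
    (d : ι → Fin n' → HahnSeries ℚ k) (r : ℕ)
    (h : RtdSet (fun a => Fin.append (c a) (d a)) r) : RtdSet (fun a => Fin.append (d a) (c a)) r := by
  have := rtdSet_perm (fun a => Fin.append (c a) (d a)) (swapEquiv n n') r h
  have e : (fun a => fun i => Fin.append (c a) (d a) (swapEquiv n n' i)) =
      (fun a => Fin.append (d a) (c a)) := by
    funext a; exact append_swapEquiv (c a) (d a)
  rw [e] at this
  exact this

/-! ## The unipotent block shear as an instance of `rtdSet_gl` -/

/-- The shear `(x, y) ↦ (x, y + N x)` as a square matrix on `Fin (n + n')`. -/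
def shearMat {n n' : ℕ} (Nm : Matrix (Fin n') (Fin n) k) : Matrix (Fin (n + n')) (Fin (n + n')) k :=
  Matrix.reindex finSumFinEquiv finSumFinEquiv (Matrix.fromBlocks 1 0 Nm 1)

theorem isUnit_det_shearMat {n n' : ℕ} (Nm : Matrix (Fin n') (Fin n) k) :
    IsUnit (shearMat Nm).det := by
  simp [shearMat]

theorem shearMat_mulVec {n n' : ℕ} (Nm : Matrix (Fin n') (Fin n) k)
    (x : Fin n → HahnSeries ℚ k) (y : Fin n' → HahnSeries ℚ k) :
    ((shearMat Nm).map (HahnSeries.C : k →+* HahnSeries ℚ k)).mulVec (Fin.append x y) =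
      Fin.append x (y + (Nm.map (HahnSeries.C : k →+* HahnSeries ℚ k)).mulVec x) := by
  classical
  funext l
  simp only [Matrix.mulVec, dotProduct, Matrix.map_apply, Fin.sum_univ_add, Fin.append_left,
    Fin.append_right, shearMat, Matrix.reindex_apply, Matrix.submatrix_apply]
  induction l using Fin.addCases with
  | left j =>
    simp [finSumFinEquiv_symm_apply_castAdd, finSumFinEquiv_symm_apply_natAdd,
      Matrix.fromBlocks_apply₁₁, Matrix.fromBlocks_apply₁₂, Matrix.one_apply, Fin.append_left,
      Finset.sum_ite_eq, apply_ite]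
  | right i =>
    simp [finSumFinEquiv_symm_apply_castAdd, finSumFinEquiv_symm_apply_natAdd,
      Matrix.fromBlocks_apply₂₁, Matrix.fromBlocks_apply₂₂, Matrix.one_apply, Fin.append_right,
      Finset.sum_ite_eq, apply_ite, Matrix.mulVec, dotProduct, add_comm]

end Summit.ResolutionOfSingularities.ResolutionOfSingularities.Cruxes.RtdLocal.CotangentShadow

/-! ## Algebra side: presentations inside an ideal, cotangent congruences, presentation independence -/

namespace Summit.ResolutionOfSingularities.ResolutionOfSingularities.Cruxes.RtdLocal.CotangentShadow

open HahnSeries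

variable {k : Type} [Field k] {K : Type} [Field K] [Algebra k K]

/-- Arcs centred at `n` (the route's `let Arc`, verbatim). -/
abbrev Arc (B : Subalgebra k K) (n : Ideal B) : Type :=
  {α : ↥B →ₐ[k] HahnSeries ℚ k // ∀ b ∈ n, 0 < (α b).orderTop}

theorem exists_poly (B : Subalgebra k K) {N : ℕ} (h : Fin N → B)
    (hgen : Algebra.adjoin k (Set.range fun i => (h i : K)) = B) (x : B) :
    ∃ P : MvPolynomial (Fin N) k, MvPolynomial.aeval h P = x := by
  have hx : (x : K) ∈ Algebra.adjoin k (Set.range fun i => (h i : K)) := by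
    rw [hgen]; exact x.2
  rw [Algebra.adjoin_range_eq_range_aeval] at hx
  obtain ⟨P, hP⟩ := hx
  refine ⟨P, Subtype.ext ?_⟩
  have hc := congrArg (fun f => f P) (MvPolynomial.comp_aeval (f := h) B.val)
  simp only [AlgHom.comp_apply, Subalgebra.coe_val] at hc
  rw [hc]
  exact hP

theorem arc_aeval {B : Subalgebra k K} {N : ℕ} (h : Fin N → B) (α : ↥B →ₐ[k] HahnSeries ℚ k)
    (P : MvPolynomial (Fin N) k) :
    α (MvPolynomial.aeval h P) = MvPolynomial.aeval (fun i => α (h i)) P := by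
  have := congrArg (fun f => f P) (MvPolynomial.comp_aeval (f := h) α)
  simpa using this

theorem arc_ext (B : Subalgebra k K) {N : ℕ} (h : Fin N → B)
    (hgen : Algebra.adjoin k (Set.range fun i => (h i : K)) = B)
    (α β : ↥B →ₐ[k] HahnSeries ℚ k) (hl : ∀ l, α (h l) = β (h l)) : α = β := by
  apply AlgHom.ext
  intro x
  obtain ⟨P, rfl⟩ := exists_poly B h hgen x
  rw [arc_aeval, arc_aeval]
  have : (fun i => α (h i)) = (fun i => β (h i)) := funext hl
  rw [this]

/-- `P(h) − P(0) ∈ (h)`. -/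
theorem aeval_sub_C_mem_span {B : Subalgebra k K} {N : ℕ} (h : Fin N → B)
    (P : MvPolynomial (Fin N) k) :
    MvPolynomial.aeval h P - algebraMap k B (MvPolynomial.constantCoeff P) ∈
      Ideal.span (Set.range h) := by
  induction P using MvPolynomial.induction_on with
  | C a => simp
  | add p q hp hq =>
    rw [map_add, map_add, map_add, add_sub_add_comm]
    exact Ideal.add_mem _ hp hq
  | mul_X p l hp =>
    rw [map_mul, map_mul, MvPolynomial.aeval_X, MvPolynomial.constantCoeff_X, mul_zero, map_zero,
      sub_zero]
    exact Ideal.mul_mem_left _ _ (Ideal.subset_span ⟨l, rfl⟩)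

/-- Residue field is `k`: every element is a constant modulo `(h)`. -/
theorem exists_const_sub_mem_span (B : Subalgebra k K) {N : ℕ} (h : Fin N → B)
    (hgen : Algebra.adjoin k (Set.range fun i => (h i : K)) = B) (b : B) :
    ∃ c : k, b - algebraMap k B c ∈ Ideal.span (Set.range h) := by
  obtain ⟨P, rfl⟩ := exists_poly B h hgen b
  exact ⟨MvPolynomial.constantCoeff P, aeval_sub_C_mem_span h P⟩

/-- If the presentation lies in a proper ideal `n`, then `n = (h)`, elementwise. -/
theorem mem_span_of_mem (B : Subalgebra k K) {N : ℕ} (h : Fin N → B)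
    (hgen : Algebra.adjoin k (Set.range fun i => (h i : K)) = B)
    (n : Ideal B) (hn : ∀ i, h i ∈ n) (hn1 : n ≠ ⊤) (x : B) (hx : x ∈ n) :
    x ∈ Ideal.span (Set.range h) := by
  obtain ⟨c, hc⟩ := exists_const_sub_mem_span B h hgen x
  have hspan : Ideal.span (Set.range h) ≤ n := by
    rw [Ideal.span_le]; rintro _ ⟨i, rfl⟩; exact hn i
  by_cases hc0 : c = 0
  · subst hc0; simpa using hc
  · exfalso
    apply hn1
    have hcmem : algebraMap k B c ∈ n := by
      have : algebraMap k B c = x - (x - algebraMap k B c) := by ring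
      rw [this]; exact n.sub_mem hx (hspan hc)
    exact Ideal.eq_top_of_isUnit_mem _ hcmem ((IsUnit.mk0 c hc0).map _)

/-- Cotangent congruence: modulo `n²`, every element of `n` is a `k`-combination of the
presentation. -/
theorem cotangent_congr (B : Subalgebra k K) {N : ℕ} (h : Fin N → B)
    (hgen : Algebra.adjoin k (Set.range fun i => (h i : K)) = B)
    (n : Ideal B) (hn : ∀ i, h i ∈ n) (hn1 : n ≠ ⊤) (x : B) (hx : x ∈ n) :
    ∃ cvec : Fin N → k, x - ∑ l, algebraMap k B (cvec l) * h l ∈ n ^ 2 := by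
  classical
  have hx' := mem_span_of_mem B h hgen n hn hn1 x hx
  rw [Ideal.span, Submodule.mem_span_range_iff_exists_fun] at hx'
  obtain ⟨bvec, hb⟩ := hx'
  choose cvec hcvec using fun l => exists_const_sub_mem_span B h hgen (bvec l)
  refine ⟨cvec, ?_⟩
  have hspan : Ideal.span (Set.range h) ≤ n := by
    rw [Ideal.span_le]; rintro _ ⟨i, rfl⟩; exact hn i
  have : x - ∑ l, algebraMap k B (cvec l) * h l = ∑ l, (bvec l - algebraMap k B (cvec l)) * h l := by
    rw [← hb]; simp [Finset.sum_sub_distrib, sub_mul, smul_eq_mul]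
  rw [this, pow_two]
  exact Ideal.sum_mem _ fun l _ => Ideal.mul_mem_mul (hspan (hcvec l)) (hn l)

/-- From `sq_dominated`: the `n²`-block of a presentation is strictly dominated by the rest. -/
theorem dominated_of_sq (B : Subalgebra k K) (n : Ideal B) {N N' : ℕ} (p : Fin N → B)
    (q : Fin N' → B) (hp : ∀ i, p i ∈ n) (hq : ∀ i, q i ∈ n ^ 2)
    (hgen : Algebra.adjoin k (Set.range fun i => ((Fin.append p q i : B) : K)) = B) :
    Dominated (fun (a : Arc B n) i => a.1 (p i)) (fun (a : Arc B n) i => a.1 (q i)) := by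
  classical
  intro a b hab
  have hmem : ∀ i, Fin.append p q i ∈ n := by
    intro i
    induction i using Fin.addCases with
    | left j => simpa [Fin.append_left] using hp j
    | right j => simpa [Fin.append_right] using Ideal.pow_le_self two_ne_zero (hq j)
  -- some generator separates a and b
  have hsep : ∃ l, a.1 (Fin.append p q l) ≠ b.1 (Fin.append p q l) := by
    by_contra hcon
    push Not at hcon
    exact hab (Subtype.ext (arc_ext B (Fin.append p q) hgen a.1 b.1 hcon))
  obtain ⟨l₁, _⟩ := hsep
  haveI : Nonempty (Fin (N + N')) := ⟨l₁⟩
  obtain ⟨lm, -, hlm⟩ := Finset.exists_min_image Finset.univ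
    (fun l => (a.1 (Fin.append p q l) - b.1 (Fin.append p q l)).orderTop) Finset.univ_nonempty
  have hmin : ∀ l, (a.1 (Fin.append p q lm) - b.1 (Fin.append p q lm)).orderTop ≤
      (a.1 (Fin.append p q l) - b.1 (Fin.append p q l)).orderTop :=
    fun l => hlm l (Finset.mem_univ l)
  have hsq : ∀ i, ∃ j, (a.1 (Fin.append p q j) - b.1 (Fin.append p q j)).orderTop <
      (a.1 (q i) - b.1 (q i)).orderTop :=
    fun i => sq_dominated B n (Fin.append p q) hmem hgen (q i) (hq i) a b hab
  induction lm using Fin.addCases with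
  | right im =>
    exfalso
    obtain ⟨j, hj⟩ := hsq im
    have := hmin j
    simp only [Fin.append_right] at this
    exact absurd (lt_of_le_of_lt this hj) (lt_irrefl _)
  | left jm =>
    refine ⟨jm, fun i => ?_⟩
    obtain ⟨j, hj⟩ := hsq i
    have := hmin j
    simp only [Fin.append_left] at this
    exact lt_of_le_of_lt this hj

end Summit.ResolutionOfSingularities.ResolutionOfSingularities.Cruxes.RtdLocal.CotangentShadow

namespace Summit.ResolutionOfSingularities.ResolutionOfSingularities.Cruxes.RtdLocal.CotangentShadow

open HahnSeries

variable {k : Type} [Field k] {K : Type} [Field K] [Algebra k K]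

theorem append_arc {B : Subalgebra k K} {n : Ideal B} {N N' : ℕ} (p : Fin N → B) (q : Fin N' → B)
    (a : Arc B n) :
    (fun i => a.1 (Fin.append p q i)) = Fin.append (fun i => a.1 (p i)) (fun i => a.1 (q i)) := by
  funext l
  induction l using Fin.addCases with
  | left j => simp [Fin.append_left]
  | right j => simp [Fin.append_right]

theorem adjoin_append_eq {B : Subalgebra k K} {N N' : ℕ} (p : Fin N → B) (q : Fin N' → B)
    (hgp : Algebra.adjoin k (Set.range fun i => (p i : K)) = B) :
    Algebra.adjoin k (Set.range fun i => ((Fin.append p q i : B) : K)) = B := by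
  apply le_antisymm
  · rw [Algebra.adjoin_le_iff]
    rintro _ ⟨i, rfl⟩
    exact (Fin.append p q i).2
  · refine hgp.symm.trans_le (Algebra.adjoin_mono ?_)
    rintro _ ⟨j, rfl⟩
    exact ⟨Fin.castAdd N' j, by simp [Fin.append_left]⟩

theorem arc_algebraMap {B : Subalgebra k K} (α : ↥B →ₐ[k] HahnSeries ℚ k) (c : k) :
    α (algebraMap k B c) = HahnSeries.C c := by
  rw [AlgHom.commutes, algebraMap_eq_C]

/-- PRESENTATION INDEPENDENCE of typed riso-triviality inside one algebra (Monreal Prop 4.4,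
typed): two presentations of `B` inside the proper ideal `n` give the same `RtdSet`. -/
theorem rtdSet_presentation (B : Subalgebra k K) (n : Ideal B) (hn1 : n ≠ ⊤) [Nonempty (Arc B n)]
    {N N' : ℕ} (p : Fin N → B) (p' : Fin N' → B) (hp : ∀ i, p i ∈ n) (hp' : ∀ i, p' i ∈ n)
    (hgp : Algebra.adjoin k (Set.range fun i => (p i : K)) = B)
    (hgp' : Algebra.adjoin k (Set.range fun i => (p' i : K)) = B) (r : ℕ)
    (h : RtdSet (fun (a : Arc B n) i => a.1 (p i)) r) :
    RtdSet (fun (a : Arc B n) i => a.1 (p' i)) r := by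
  classical
  choose Nm hNm using fun i => cotangent_congr B p hgp n hp hn1 (p' i) (hp' i)
  choose Nm' hNm' using fun i => cotangent_congr B p' hgp' n hp' hn1 (p i) (hp i)
  set q : Fin N' → B := fun i => p' i - ∑ l, algebraMap k B (Nm i l) * p l with hq
  set q' : Fin N → B := fun i => p i - ∑ l, algebraMap k B (Nm' i l) * p' l with hq'
  have hqmem : ∀ i, q i ∈ n ^ 2 := fun i => hNm i
  have hq'mem : ∀ i, q' i ∈ n ^ 2 := fun i => hNm' i
  -- Step 1: pad with the dominated block q
  have hdom : Dominated (fun (a : Arc B n) i => a.1 (p i)) (fun (a : Arc B n) i => a.1 (q i)) :=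
    dominated_of_sq B n p q hp hqmem (adjoin_append_eq p q hgp)
  have h1 := rtdSet_pad _ _ hdom r h
  -- Step 2: shear (p, q) ↦ (p, p')
  have h2 := rtdSet_gl _ (shearMat (Matrix.of Nm)) (isUnit_det_shearMat _) r h1
  have h2' : RtdSet (fun (a : Arc B n) =>
      Fin.append (fun i => a.1 (p i)) (fun i => a.1 (p' i))) r := by
    convert h2 using 2
    funext a
    rw [shearMat_mulVec]
    congr 1
    funext i
    simp only [hq, map_sub, map_sum, map_mul, arc_algebraMap, Pi.add_apply, Matrix.mulVec,
      dotProduct, Matrix.map_apply, Matrix.of_apply]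
    ring
  -- Step 3: swap the blocks
  have h3 := rtdSet_swap _ _ r h2'
  -- Step 4: shear (p', p) ↦ (p', q')
  have h4 := rtdSet_gl _ (shearMat (-(Matrix.of Nm'))) (isUnit_det_shearMat _) r h3
  have h4' : RtdSet (fun (a : Arc B n) =>
      Fin.append (fun i => a.1 (p' i)) (fun i => a.1 (q' i))) r := by
    convert h4 using 2
    funext a
    rw [shearMat_mulVec]
    congr 1
    funext i
    simp only [hq', map_sub, map_sum, map_mul, arc_algebraMap, Pi.add_apply, Matrix.mulVec,
      dotProduct, Matrix.map_apply, Matrix.of_apply, Matrix.neg_apply, map_neg, neg_mul,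
      Finset.sum_neg_distrib]
    ring
  -- Step 5: collapse the dominated block q'
  have hdom' : Dominated (fun (a : Arc B n) i => a.1 (p' i)) (fun (a : Arc B n) i => a.1 (q' i)) :=
    dominated_of_sq B n p' q' hp' hq'mem (adjoin_append_eq p' q' hgp')
  exact rtdSet_collapse _ _ hdom' r h4'

end Summit.ResolutionOfSingularities.ResolutionOfSingularities.Cruxes.RtdLocal.CotangentShadow

/-! ## The localisation `B ⊆ B[s⁻¹] = adjoin k (B ∪ {s⁻¹})`: arcs biject -/

namespace Summit.ResolutionOfSingularities.ResolutionOfSingularities.Cruxes.RtdLocal.CotangentShadow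

open HahnSeries

variable {k : Type} [Field k] {K : Type} [Field K] [Algebra k K]

section Loc

variable (B : Subalgebra k K) (s : K)

/-- `B[s⁻¹]` exactly as in the route: `adjoin k (B ∪ {s⁻¹})`. -/
abbrev Bs : Subalgebra k K := Algebra.adjoin k ((B : Set K) ∪ {s⁻¹})

theorem le_Bs : B ≤ Bs B s := fun _ hx => Algebra.subset_adjoin (Set.mem_union_left _ hx)

theorem inv_mem_Bs : s⁻¹ ∈ Bs B s := Algebra.subset_adjoin (Set.mem_union_right _ rfl)

variable {B s}

theorem exists_of_mem_Bs (hs : s ∈ B) (hs0 : s ≠ 0) {z : K} (hz : z ∈ Bs B s) :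
    ∃ b ∈ B, ∃ e : ℕ, z = b * (s ^ e)⁻¹ := by
  refine Algebra.adjoin_induction ?_ ?_ ?_ ?_ hz
  · rintro x (hx | hx)
    · exact ⟨x, hx, 0, by simp⟩
    · rw [Set.mem_singleton_iff] at hx
      subst hx
      exact ⟨1, B.one_mem, 1, by simp⟩
  · intro c
    exact ⟨algebraMap k K c, B.algebraMap_mem c, 0, by simp⟩
  · rintro x y - - ⟨b₁, hb₁, e₁, rfl⟩ ⟨b₂, hb₂, e₂, rfl⟩
    refine ⟨b₁ * s ^ e₂ + b₂ * s ^ e₁,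
      B.add_mem (B.mul_mem hb₁ (B.pow_mem hs _)) (B.mul_mem hb₂ (B.pow_mem hs _)), e₁ + e₂, ?_⟩
    field_simp
    ring
  · rintro x y - - ⟨b₁, hb₁, e₁, rfl⟩ ⟨b₂, hb₂, e₂, rfl⟩
    refine ⟨b₁ * b₂, B.mul_mem hb₁ hb₂, e₁ + e₂, ?_⟩
    field_simp
    ring

/-- The `B`-algebra structure on `B[s⁻¹]` given by the inclusion. -/
@[reducible] noncomputable def algBs (B : Subalgebra k K) (s : K) : Algebra B (Bs B s) :=
  (Subalgebra.inclusion (le_Bs B s)).toRingHom.toAlgebra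

theorem isUnit_incl_s (hs : s ∈ B) (hs0 : s ≠ 0) :
    IsUnit (Subalgebra.inclusion (le_Bs B s) ⟨s, hs⟩) := by
  refine IsUnit.of_mul_eq_one ⟨s⁻¹, inv_mem_Bs B s⟩ (Subtype.ext ?_)
  simp [mul_inv_cancel₀ hs0]

theorem isLocalization_Bs (hs : s ∈ B) (hs0 : s ≠ 0) :
    @IsLocalization _ _ (Submonoid.powers (⟨s, hs⟩ : B)) (Bs B s) _ (algBs B s) := by
  letI := algBs B s
  have halg : ∀ b : B, algebraMap B (Bs B s) b = Subalgebra.inclusion (le_Bs B s) b := fun b => rfl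
  refine ⟨?_, ?_, ?_⟩
  · rintro ⟨y, e, rfl⟩
    rw [halg, map_pow]
    exact (isUnit_incl_s hs hs0).pow e
  · intro z
    obtain ⟨b, hb, e, hz⟩ := exists_of_mem_Bs hs hs0 z.2
    refine ⟨(⟨b, hb⟩, ⟨⟨s, hs⟩ ^ e, e, rfl⟩), Subtype.ext ?_⟩
    simp only [halg, map_pow, Subalgebra.coe_mul, Subalgebra.coe_pow, Subalgebra.coe_inclusion]
    rw [hz, inv_mul_cancel_right₀ (pow_ne_zero e hs0)]
  · intro x y hxy
    refine ⟨1, ?_⟩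
    rw [halg, halg] at hxy
    have := Subalgebra.inclusion_injective (le_Bs B s) hxy
    simp [this]

theorem orderTop_arc_s {m : Ideal B} (hs : s ∈ B) (α : Arc B m) {c : k} (hc0 : c ≠ 0)
    (hc : (⟨s, hs⟩ : B) - algebraMap k B c ∈ m) : (α.1 ⟨s, hs⟩).orderTop = 0 := by
  have hsplit : α.1 ⟨s, hs⟩ = α.1 (⟨s, hs⟩ - algebraMap k B c) + HahnSeries.C c := by
    rw [map_sub, arc_algebraMap]; ring
  have hpos := α.2 _ hc
  have hC : (HahnSeries.C c : HahnSeries ℚ k).orderTop = 0 := by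
    rw [HahnSeries.C_apply, HahnSeries.orderTop_single hc0]; rfl
  rw [hsplit, HahnSeries.orderTop_add_eq_right (by rw [hC]; exact hpos), hC]

theorem isUnit_arc_s {m : Ideal B} (hs : s ∈ B) (α : Arc B m) {c : k} (hc0 : c ≠ 0)
    (hc : (⟨s, hs⟩ : B) - algebraMap k B c ∈ m) : IsUnit (α.1 ⟨s, hs⟩) := by
  rw [isUnit_iff_ne_zero]
  intro h0
  have := orderTop_arc_s hs α hc0 hc
  rw [h0, HahnSeries.orderTop_zero] at this
  exact WithTop.top_ne_coe this

theorem orderTop_pow_eq_zero {x : HahnSeries ℚ k} (hx : x.orderTop = 0) (e : ℕ) :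
    (x ^ e).orderTop = 0 := by
  induction e with
  | zero => simp
  | succ e ih => rw [pow_succ, HahnSeries.orderTop_mul, ih, hx, add_zero]

/-- Extension of an arc of `B` (with `α s` a unit) to `B[s⁻¹]`, by the universal property of
localisation. -/
noncomputable def extArc (hs : s ∈ B) (hs0 : s ≠ 0) (α : ↥B →ₐ[k] HahnSeries ℚ k)
    (hunit : IsUnit (α ⟨s, hs⟩)) : ↥(Bs B s) →ₐ[k] HahnSeries ℚ k :=
  letI := algBs B s
  haveI := isLocalization_Bs hs hs0
  have hg : ∀ y : Submonoid.powers (⟨s, hs⟩ : B), IsUnit (α.toRingHom y) := by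
    rintro ⟨y, e, rfl⟩
    simp only [AlgHom.toRingHom_eq_coe, RingHom.coe_coe, map_pow]
    exact hunit.pow e
  { IsLocalization.lift (M := Submonoid.powers (⟨s, hs⟩ : B)) hg with
    commutes' := fun c => by
      have h1 : algebraMap k (Bs B s) c = algebraMap B (Bs B s) (algebraMap k B c) :=
        Subtype.ext rfl
      simp only [RingHom.toMonoidHom_eq_coe, OneHom.toFun_eq_coe, MonoidHom.toOneHom_coe,
        MonoidHom.coe_coe]
      rw [h1, IsLocalization.lift_eq]
      exact α.commutes c }

theorem extArc_incl (hs : s ∈ B) (hs0 : s ≠ 0) (α : ↥B →ₐ[k] HahnSeries ℚ k)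
    (hunit : IsUnit (α ⟨s, hs⟩)) (b : B) :
    extArc hs hs0 α hunit (Subalgebra.inclusion (le_Bs B s) b) = α b := by
  letI := algBs B s
  haveI := isLocalization_Bs hs hs0
  show IsLocalization.lift (M := Submonoid.powers (⟨s, hs⟩ : B)) _ (algebraMap B (Bs B s) b) = _
  rw [IsLocalization.lift_eq]
  rfl

/-- Two arcs of `B[s⁻¹]` agreeing on `B` agree. -/
theorem arcBs_ext (hs : s ∈ B) (hs0 : s ≠ 0) (β γ : ↥(Bs B s) →ₐ[k] HahnSeries ℚ k)
    (h : ∀ b : B, β (Subalgebra.inclusion (le_Bs B s) b) = γ (Subalgebra.inclusion (le_Bs B s) b)) :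
    β = γ := by
  letI := algBs B s
  haveI := isLocalization_Bs hs hs0
  apply AlgHom.coe_ringHom_injective
  apply IsLocalization.ringHom_ext (Submonoid.powers (⟨s, hs⟩ : B))
  refine RingHom.ext fun b => ?_
  exact h b

/-- ARC BIJECTION along `B ⊆ B[s⁻¹]`: restriction is a bijection between arcs of `B[s⁻¹]`
centred at `m'` and arcs of `B` centred at `m = m' ∩ B`, as soon as `s ≡ c ≠ 0 (mod m)`. -/
noncomputable def resEquiv (hs : s ∈ B) (hs0 : s ≠ 0) (m' : Ideal ↥(Bs B s)) {c : k}
    (hc0 : c ≠ 0)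
    (hc : (⟨s, hs⟩ : B) - algebraMap k B c ∈ m'.comap (Subalgebra.inclusion (le_Bs B s))) :
    Arc (Bs B s) m' ≃ Arc B (m'.comap (Subalgebra.inclusion (le_Bs B s))) where
  toFun a := ⟨a.1.comp (Subalgebra.inclusion (le_Bs B s)), fun b hb => a.2 _ hb⟩
  invFun a := ⟨extArc hs hs0 a.1 (isUnit_arc_s hs a hc0 hc), by
    letI := algBs B s
    haveI := isLocalization_Bs hs hs0
    intro z hz
    obtain ⟨⟨b, y, e, rfl⟩, hz'⟩ :=
      IsLocalization.surj (Submonoid.powers (⟨s, hs⟩ : B)) z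
    -- hz' : z * algebraMap (s^e) = algebraMap b
    have halg : ∀ b : B, algebraMap B (Bs B s) b = Subalgebra.inclusion (le_Bs B s) b :=
      fun b => rfl
    simp only [halg, map_pow] at hz'
    have hbm : b ∈ m'.comap (Subalgebra.inclusion (le_Bs B s)) := by
      rw [Ideal.mem_comap, ← hz']
      exact m'.mul_mem_right _ hz
    have hval := congrArg (extArc hs hs0 a.1 (isUnit_arc_s hs a hc0 hc)) hz'
    rw [map_mul, map_pow, extArc_incl, extArc_incl] at hval
    have hord := congrArg HahnSeries.orderTop hval
    rw [HahnSeries.orderTop_mul, orderTop_pow_eq_zero (orderTop_arc_s hs a hc0 hc), add_zero]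
      at hord
    rw [hord]
    exact a.2 b hbm⟩
  left_inv a := by
    apply Subtype.ext
    apply arcBs_ext hs hs0
    intro b
    rw [extArc_incl]
    rfl
  right_inv a := by
    apply Subtype.ext
    apply AlgHom.ext
    intro b
    exact extArc_incl hs hs0 a.1 (isUnit_arc_s hs a hc0 hc) b

end Loc

end Summit.ResolutionOfSingularities.ResolutionOfSingularities.Cruxes.RtdLocal.CotangentShadow

/-! ## The one localisation-specific congruence, generation, constant arc, presentations -/

namespace Summit.ResolutionOfSingularities.ResolutionOfSingularities.Cruxes.RtdLocal.CotangentShadow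

open HahnSeries

variable {k : Type} [Field k] {K : Type} [Field K] [Algebra k K]
variable {B : Subalgebra k K} {s : K}

/-- `u := s⁻¹ − c⁻¹ ∈ B[s⁻¹]`. -/
noncomputable def uEl (B : Subalgebra k K) (s : K) (c : k) : ↥(Bs B s) :=
  ⟨s⁻¹, inv_mem_Bs B s⟩ - algebraMap k (Bs B s) c⁻¹

theorem uEl_eq (hs : s ∈ B) (hs0 : s ≠ 0) {c : k} (hc0 : c ≠ 0) :
    uEl B s c = -(algebraMap k (Bs B s) c⁻¹) * ⟨s⁻¹, inv_mem_Bs B s⟩ *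
      Subalgebra.inclusion (le_Bs B s) (⟨s, hs⟩ - algebraMap k B c) := by
  apply Subtype.ext
  have hc' : algebraMap k K c ≠ 0 := by
    rw [map_ne_zero_iff _ (algebraMap k K).injective]; exact hc0
  simp only [uEl, Subalgebra.coe_sub, Subalgebra.coe_algebraMap, Subalgebra.coe_mul,
    Subalgebra.coe_neg, Subalgebra.coe_inclusion, map_inv₀]
  field_simp
  ring

theorem uEl_mem (hs : s ∈ B) (hs0 : s ≠ 0) {c : k} (hc0 : c ≠ 0) (m' : Ideal ↥(Bs B s))
    (hc : (⟨s, hs⟩ : B) - algebraMap k B c ∈ m'.comap (Subalgebra.inclusion (le_Bs B s))) :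
    uEl B s c ∈ m' := by
  rw [uEl_eq hs hs0 hc0]
  exact m'.mul_mem_left _ hc

theorem inv_eq_uEl_add (c : k) :
    (⟨s⁻¹, inv_mem_Bs B s⟩ : ↥(Bs B s)) = uEl B s c + algebraMap k (Bs B s) c⁻¹ := by
  simp [uEl]

theorem incl_mem_sq {m' : Ideal ↥(Bs B s)} {d : B}
    (hd : d ∈ (m'.comap (Subalgebra.inclusion (le_Bs B s))) ^ 2) :
    Subalgebra.inclusion (le_Bs B s) d ∈ m' ^ 2 := by
  have h1 : Subalgebra.inclusion (le_Bs B s) d ∈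
      ((m'.comap (Subalgebra.inclusion (le_Bs B s))) ^ 2).map (Subalgebra.inclusion (le_Bs B s)) :=
    Ideal.mem_map_of_mem _ hd
  rw [Ideal.map_pow] at h1
  have h2 : (m'.comap (Subalgebra.inclusion (le_Bs B s))).map (Subalgebra.inclusion (le_Bs B s))
      ≤ m' := Ideal.map_comap_le
  rw [pow_two] at h1 ⊢
  exact Ideal.mul_mono h2 h2 h1

/-- THE localisation congruence: `u ≡ Σ μ_l g_l (mod m'²)` with constant coefficients. -/
theorem uEl_congr (hs : s ∈ B) (hs0 : s ≠ 0) {c : k} (hc0 : c ≠ 0) (m' : Ideal ↥(Bs B s))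
    (hm1 : m'.comap (Subalgebra.inclusion (le_Bs B s)) ≠ ⊤)
    (hc : (⟨s, hs⟩ : B) - algebraMap k B c ∈ m'.comap (Subalgebra.inclusion (le_Bs B s)))
    {N : ℕ} (g : Fin N → B) (hgm : ∀ i, g i ∈ m'.comap (Subalgebra.inclusion (le_Bs B s)))
    (hggen : Algebra.adjoin k (Set.range fun i => (g i : K)) = B) :
    ∃ μ : Fin N → k, uEl B s c - ∑ l, algebraMap k (Bs B s) (μ l) *
      Subalgebra.inclusion (le_Bs B s) (g l) ∈ m' ^ 2 := by
  classical
  obtain ⟨lam, hlam⟩ := cotangent_congr B g hggen _ hgm hm1 _ hc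
  set μ : Fin N → k := fun l => -(c⁻¹ * c⁻¹ * lam l) with hμ
  refine ⟨μ, ?_⟩
  set d : B := (⟨s, hs⟩ - algebraMap k B c) - ∑ l, algebraMap k B (lam l) * g l with hd
  have hc' : algebraMap k K c ≠ 0 := by
    rw [map_ne_zero_iff _ (algebraMap k K).injective]; exact hc0
  have hsum1 : ((∑ l, algebraMap k (Bs B s) (μ l) * Subalgebra.inclusion (le_Bs B s) (g l) :
      ↥(Bs B s)) : K) = -((algebraMap k K c)⁻¹ * (algebraMap k K c)⁻¹) *
        ∑ l, algebraMap k K (lam l) * (g l : K) := by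
    rw [AddSubmonoidClass.coe_finsetSum, Finset.mul_sum]
    refine Finset.sum_congr rfl fun l _ => ?_
    simp only [hμ, Subalgebra.coe_mul, Subalgebra.coe_algebraMap, Subalgebra.coe_inclusion,
      Subalgebra.coe_neg, map_neg, map_mul, map_inv₀]
    ring
  have hsum2 : ((∑ l, algebraMap k B (lam l) * g l : B) : K) =
      ∑ l, algebraMap k K (lam l) * (g l : K) := by
    rw [AddSubmonoidClass.coe_finsetSum]
    refine Finset.sum_congr rfl fun l _ => ?_
    simp only [Subalgebra.coe_mul, Subalgebra.coe_algebraMap]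
  have hident : uEl B s c - ∑ l, algebraMap k (Bs B s) (μ l) *
        Subalgebra.inclusion (le_Bs B s) (g l)
      = -(algebraMap k (Bs B s) c⁻¹) * (uEl B s c *
          Subalgebra.inclusion (le_Bs B s) (⟨s, hs⟩ - algebraMap k B c))
        - algebraMap k (Bs B s) (c⁻¹ * c⁻¹) * Subalgebra.inclusion (le_Bs B s) d := by
    apply Subtype.ext
    rw [Subalgebra.coe_sub, hsum1]
    simp only [uEl, hd, Subalgebra.coe_sub, Subalgebra.coe_algebraMap, Subalgebra.coe_mul,
      Subalgebra.coe_neg, Subalgebra.coe_inclusion, map_inv₀, map_mul, map_sub, hsum2]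
    set S := ∑ x, (algebraMap k K) (lam x) * (g x : K) with hS
    field_simp
    ring
  rw [hident]
  refine (m' ^ 2).sub_mem ?_ ?_
  · refine (m' ^ 2).mul_mem_left _ ?_
    rw [pow_two]
    exact Ideal.mul_mem_mul (uEl_mem hs hs0 hc0 m' hc) hc
  · refine (m' ^ 2).mul_mem_left _ (incl_mem_sq ?_)
    rw [hd]; exact hlam

/-- Generation: a presentation of `B` together with any extra block generates `B[s⁻¹]` as
soon as `s⁻¹` is reached. -/
theorem adjoin_eq_Bs {N N' : ℕ} (g : Fin N → B)
    (hggen : Algebra.adjoin k (Set.range fun i => (g i : K)) = B) (x : Fin N' → ↥(Bs B s))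
    (hinv : (s⁻¹ : K) ∈ Algebra.adjoin k (Set.range fun i =>
      ((Fin.append (fun i => Subalgebra.inclusion (le_Bs B s) (g i)) x i : ↥(Bs B s)) : K))) :
    Algebra.adjoin k (Set.range fun i =>
      ((Fin.append (fun i => Subalgebra.inclusion (le_Bs B s) (g i)) x i : ↥(Bs B s)) : K))
      = Bs B s := by
  apply le_antisymm
  · rw [Algebra.adjoin_le_iff]
    rintro _ ⟨i, rfl⟩
    exact SetLike.coe_mem _
  · show Algebra.adjoin k ((B : Set K) ∪ {s⁻¹}) ≤ _
    rw [Algebra.adjoin_le_iff]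
    rintro y (hy | hy)
    · have hy' : y ∈ Algebra.adjoin k (Set.range fun i => (g i : K)) := by rw [hggen]; exact hy
      refine Algebra.adjoin_mono ?_ hy'
      rintro _ ⟨j, rfl⟩
      exact ⟨Fin.castAdd N' j, by simp [Fin.append_left]⟩
    · rw [Set.mem_singleton_iff] at hy
      subst hy
      exact hinv

/-- The CONSTANT ARC: residue field `k` gives an arc (so `Arc A n` is inhabited). -/
theorem nonempty_arc (A : Subalgebra k K) (n : Ideal A) [hn : n.IsMaximal]
    (hres : ∀ x : A, ∃ c : k, x - algebraMap k A c ∈ n) : Nonempty (Arc A n) := by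
  have hinj : Function.Injective (algebraMap k (A ⧸ n)) := (algebraMap k (A ⧸ n)).injective
  have hsurj : Function.Surjective (algebraMap k (A ⧸ n)) := by
    intro y
    obtain ⟨x, rfl⟩ := Ideal.Quotient.mk_surjective y
    obtain ⟨c, hc⟩ := hres x
    refine ⟨c, ?_⟩
    rw [IsScalarTower.algebraMap_apply k A (A ⧸ n), Ideal.Quotient.algebraMap_eq, eq_comm,
      Ideal.Quotient.mk_eq_mk_iff_sub_mem]
    exact hc
  let e : k ≃ₐ[k] (A ⧸ n) := AlgEquiv.ofBijective (Algebra.ofId k (A ⧸ n)) ⟨hinj, hsurj⟩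
  let α : A →ₐ[k] HahnSeries ℚ k :=
    (Algebra.ofId k (HahnSeries ℚ k)).comp
      (e.symm.toAlgHom.comp (Ideal.Quotient.mkₐ k n))
  refine ⟨⟨α, fun b hb => ?_⟩⟩
  have h0 : Ideal.Quotient.mk n b = 0 := Ideal.Quotient.eq_zero_iff_mem.2 hb
  simp [α, Ideal.Quotient.mkₐ_eq_mk, h0]

/-- A finitely generated `B` with residue field `k` at `m` has a presentation INSIDE `m`. -/
theorem exists_presentation (B : Subalgebra k K) (hFG : B.FG) (m : Ideal B)
    (hres : ∀ x : B, ∃ c : k, x - algebraMap k B c ∈ m) :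
    ∃ (N : ℕ) (g : Fin N → B), (∀ i, g i ∈ m) ∧
      Algebra.adjoin k (Set.range fun i => (g i : K)) = B := by
  classical
  obtain ⟨t, ht⟩ := hFG
  have htB : ∀ x ∈ t, x ∈ B := fun x hx => ht ▸ Algebra.subset_adjoin hx
  let f : Fin t.card → K := fun i => (t.equivFin.symm i : K)
  have hf : ∀ i, f i ∈ t := fun i => (t.equivFin.symm i).2
  have hfsurj : ∀ x ∈ t, ∃ i, f i = x := fun x hx =>
    ⟨t.equivFin ⟨x, hx⟩, by simp [f]⟩
  choose c hc using fun i => hres ⟨f i, htB _ (hf i)⟩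
  refine ⟨t.card, fun i => ⟨f i, htB _ (hf i)⟩ - algebraMap k B (c i), fun i => hc i, ?_⟩
  apply le_antisymm
  · rw [Algebra.adjoin_le_iff]
    rintro _ ⟨i, rfl⟩
    exact SetLike.coe_mem _
  · refine ht.symm.trans_le ?_
    rw [Algebra.adjoin_le_iff]
    intro x hx
    obtain ⟨i, rfl⟩ := hfsurj x hx
    have : f i = ((⟨f i, htB _ (hf i)⟩ - algebraMap k B (c i) : B) : K) + algebraMap k K (c i) := by
      simp
    rw [this]
    exact Subalgebra.add_mem _ (Algebra.subset_adjoin ⟨i, rfl⟩) (Subalgebra.algebraMap_mem _ _)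

end Summit.ResolutionOfSingularities.ResolutionOfSingularities.Cruxes.RtdLocal.CotangentShadow


/-! ## Assembly: `RtdLocal` -/

namespace Summit.ResolutionOfSingularities.ResolutionOfSingularities.Cruxes.RtdLocal.CotangentShadow

open HahnSeries

variable {k : Type} [Field k] {K : Type} [Field K] [Algebra k K]

/-- The route's `Rtd B m r`, verbatim, with clauses (1)(2)(3) named `RtdSet`. -/
def RtdPres (B : Subalgebra k K) (m : Ideal B) (r : ℕ) : Prop :=
  ∃ (n : ℕ) (g : Fin n → ↥B), (∀ i, g i ∈ m) ∧
    Algebra.adjoin k (Set.range fun i => (g i : K)) = B ∧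
    RtdSet (fun (a : Arc B m) i => a.1 (g i)) r

theorem inv_mem_adjoin_of_uEl {B : Subalgebra k K} {s : K} (c : k) {N : ℕ} (g : Fin N → B)
    (x : ↥(Bs B s)) (μ : Fin N → k)
    (hx : (x : K) = (uEl B s c : K) - ∑ l, algebraMap k K (μ l) * (g l : K)) :
    (s⁻¹ : K) ∈ Algebra.adjoin k (Set.range fun i =>
      ((Fin.append (fun i => Subalgebra.inclusion (le_Bs B s) (g i)) (fun _ : Fin 1 => x) i :
        ↥(Bs B s)) : K)) := by
  have h1 := congrArg (fun z : ↥(Bs B s) => (z : K)) (inv_eq_uEl_add (B := B) (s := s) c)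
  simp only [Subalgebra.coe_add, Subalgebra.coe_algebraMap] at h1
  have : (s⁻¹ : K) = (x : K) + (∑ l, algebraMap k K (μ l) * (g l : K)) + algebraMap k K c⁻¹ := by
    rw [h1, hx]; ring
  rw [this]
  refine Subalgebra.add_mem _ (Subalgebra.add_mem _ (Algebra.subset_adjoin
    ⟨Fin.natAdd N 0, by simp [Fin.append_right]⟩) (Subalgebra.sum_mem _ fun l _ =>
      Subalgebra.mul_mem _ (Subalgebra.algebraMap_mem _ _)
        (Algebra.subset_adjoin ⟨Fin.castAdd 1 l, by simp [Fin.append_left]⟩)))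
    (Subalgebra.algebraMap_mem _ _)

/-- **RtdLocal, cotangent-shadow proof** (Monreal Prop 4.2 / Lemma 3.21 / Prop 4.4, typed):
Zariski-locality of typed riso-triviality under `B ↦ B[s⁻¹]`. -/
theorem rtdLocal_main (B : Subalgebra k K) (s : K) (hs : s ∈ B) (hs0 : s ≠ 0) (hFG : B.FG)
    (m' : Ideal ↥(Bs B s)) (hm' : m'.IsMaximal) (r : ℕ) :
    RtdPres (Bs B s) m' r ↔ RtdPres B (m'.comap (Subalgebra.inclusion (le_Bs B s))) r := by
  classical
  have hm'1 : m' ≠ ⊤ := hm'.ne_top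
  have hm1 : m'.comap (Subalgebra.inclusion (le_Bs B s)) ≠ ⊤ := Ideal.comap_ne_top _ hm'1
  have hsm : (⟨s, hs⟩ : B) ∉ m'.comap (Subalgebra.inclusion (le_Bs B s)) := fun h =>
    hm'1 (Ideal.eq_top_of_isUnit_mem m' h (isUnit_incl_s hs hs0))
  have key : (∀ x : B, ∃ c : k, x - algebraMap k B c ∈ m'.comap (Subalgebra.inclusion (le_Bs B s)))
      → ∃ c : k, c ≠ 0 ∧
        (⟨s, hs⟩ : B) - algebraMap k B c ∈ m'.comap (Subalgebra.inclusion (le_Bs B s)) := by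
    intro hres
    obtain ⟨c, hc⟩ := hres ⟨s, hs⟩
    refine ⟨c, ?_, hc⟩
    rintro rfl
    apply hsm
    simpa using hc
  -- shared: from c and a presentation g of B inside m, the q₁-block machinery
  have blockgen : ∀ {c : k} {N : ℕ} (g : Fin N → B)
      (hggen : Algebra.adjoin k (Set.range fun i => (g i : K)) = B) (μ : Fin N → k),
      Algebra.adjoin k (Set.range fun i =>
        ((Fin.append (fun i => Subalgebra.inclusion (le_Bs B s) (g i))
          (fun _ : Fin 1 => uEl B s c - ∑ l, algebraMap k (Bs B s) (μ l) *
            Subalgebra.inclusion (le_Bs B s) (g l)) i : ↥(Bs B s)) : K)) = Bs B s := by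
    intro c N g hggen μ
    refine adjoin_eq_Bs g hggen _ (inv_mem_adjoin_of_uEl c g _ μ ?_)
    simp only [Subalgebra.coe_sub, AddSubmonoidClass.coe_finsetSum, Subalgebra.coe_mul,
      Subalgebra.coe_algebraMap, Subalgebra.coe_inclusion]
  have ugen : ∀ {c : k} {N : ℕ} (g : Fin N → B)
      (hggen : Algebra.adjoin k (Set.range fun i => (g i : K)) = B),
      Algebra.adjoin k (Set.range fun i =>
        ((Fin.append (fun i => Subalgebra.inclusion (le_Bs B s) (g i))
          (fun _ : Fin 1 => uEl B s c) i : ↥(Bs B s)) : K)) = Bs B s := by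
    intro c N g hggen
    refine adjoin_eq_Bs g hggen _ (inv_mem_adjoin_of_uEl c g _ (fun _ => 0) ?_)
    simp
  constructor
  · -- (⇒) : from B[s⁻¹] down to B
    rintro ⟨N', g', hg'm, hg'gen, hR'⟩
    have hres' : ∀ x : ↥(Bs B s), ∃ c : k, x - algebraMap k (Bs B s) c ∈ m' := fun x => by
      obtain ⟨c, hc⟩ := exists_const_sub_mem_span (Bs B s) g' hg'gen x
      exact ⟨c, (Ideal.span_le.2 (by rintro _ ⟨i, rfl⟩; exact hg'm i)) hc⟩
    have hres : ∀ x : B, ∃ c : k,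
        x - algebraMap k B c ∈ m'.comap (Subalgebra.inclusion (le_Bs B s)) := fun x => by
      obtain ⟨c, hc⟩ := hres' (Subalgebra.inclusion (le_Bs B s) x)
      refine ⟨c, ?_⟩
      rw [Ideal.mem_comap, map_sub, AlgHom.commutes]
      exact hc
    obtain ⟨c, hc0, hc⟩ := key hres
    haveI : m'.IsMaximal := hm'
    haveI hne : Nonempty (Arc (Bs B s) m') := nonempty_arc (Bs B s) m' hres'
    obtain ⟨N₀, g₀, hg₀m, hg₀gen⟩ := exists_presentation B hFG _ hres
    have humem : uEl B s c ∈ m' := uEl_mem hs hs0 hc0 m' hc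
    -- the presentation h₀ = (g₀, u) of B[s⁻¹] inside m'
    have hh₀m : ∀ i, Fin.append (fun i => Subalgebra.inclusion (le_Bs B s) (g₀ i))
        (fun _ : Fin 1 => uEl B s c) i ∈ m' := by
      intro i
      induction i using Fin.addCases with
      | left j => simpa [Fin.append_left] using hg₀m j
      | right j => simpa [Fin.append_right] using humem
    -- Step A: presentation independence inside B[s⁻¹]
    have hA := rtdSet_presentation (Bs B s) m' hm'1 g' _ hg'm hh₀m hg'gen (ugen g₀ hg₀gen) r hR'
    have hA' : RtdSet (fun (a : Arc (Bs B s) m') =>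
        Fin.append (fun i => a.1 (Subalgebra.inclusion (le_Bs B s) (g₀ i)))
          (fun _ : Fin 1 => a.1 (uEl B s c))) r := by
      convert hA using 1
      funext a
      exact (append_arc _ _ a).symm
    -- Step B: shear off the congruence, collapse the dominated block
    obtain ⟨μ, hμ⟩ := uEl_congr hs hs0 hc0 m' hm1 hc g₀ hg₀m hg₀gen
    have hB := rtdSet_gl _ (shearMat (-(Matrix.of fun (_ : Fin 1) l => μ l)))
      (isUnit_det_shearMat _) r hA'
    have hB' : RtdSet (fun (a : Arc (Bs B s) m') =>
        Fin.append (fun i => a.1 (Subalgebra.inclusion (le_Bs B s) (g₀ i)))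
          (fun _ : Fin 1 => a.1 (uEl B s c - ∑ l, algebraMap k (Bs B s) (μ l) *
            Subalgebra.inclusion (le_Bs B s) (g₀ l)))) r := by
      convert hB using 2
      funext a
      rw [shearMat_mulVec]
      congr 1
      funext i
      simp only [map_sub, map_sum, map_mul, arc_algebraMap, Pi.add_apply, Matrix.mulVec,
        dotProduct, Matrix.map_apply, Matrix.of_apply, Matrix.neg_apply, map_neg, neg_mul,
        Finset.sum_neg_distrib]
      ring
    have hdom : Dominated
        (fun (a : Arc (Bs B s) m') i => a.1 (Subalgebra.inclusion (le_Bs B s) (g₀ i)))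
        (fun (a : Arc (Bs B s) m') (_ : Fin 1) => a.1 (uEl B s c -
          ∑ l, algebraMap k (Bs B s) (μ l) * Subalgebra.inclusion (le_Bs B s) (g₀ l))) :=
      dominated_of_sq (Bs B s) m' (fun i => Subalgebra.inclusion (le_Bs B s) (g₀ i))
        (fun _ => _) (fun i => hg₀m i) (fun _ => hμ) (blockgen g₀ hg₀gen μ)
    have hC := rtdSet_collapse _ _ hdom r hB'
    -- Step C: transport to arcs of B along the arc bijection
    have hD := rtdSet_reindex _ (resEquiv hs hs0 m' hc0 hc).symm r hC
    refine ⟨N₀, g₀, hg₀m, hg₀gen, ?_⟩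
    convert hD using 1
    funext a
    funext i
    exact (congrArg (fun (b : Arc B (m'.comap (Subalgebra.inclusion (le_Bs B s)))) =>
      b.1 (g₀ i)) ((resEquiv hs hs0 m' hc0 hc).apply_symm_apply a)).symm
  · -- (⇐) : from B up to B[s⁻¹]
    rintro ⟨N, g, hgm, hggen, hR⟩
    have hres : ∀ x : B, ∃ c : k,
        x - algebraMap k B c ∈ m'.comap (Subalgebra.inclusion (le_Bs B s)) := fun x => by
      obtain ⟨c, hc⟩ := exists_const_sub_mem_span B g hggen x
      exact ⟨c, (Ideal.span_le.2 (by rintro _ ⟨i, rfl⟩; exact hgm i)) hc⟩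
    obtain ⟨c, hc0, hc⟩ := key hres
    have humem : uEl B s c ∈ m' := uEl_mem hs hs0 hc0 m' hc
    -- transport the witness to arcs of B[s⁻¹]
    have h1 : RtdSet (fun (a : Arc (Bs B s) m') i =>
        a.1 (Subalgebra.inclusion (le_Bs B s) (g i))) r :=
      rtdSet_reindex _ (resEquiv hs hs0 m' hc0 hc) r hR
    -- pad with the dominated block q₁ = u − Σ μ g
    obtain ⟨μ, hμ⟩ := uEl_congr hs hs0 hc0 m' hm1 hc g hgm hggen
    have hdom : Dominated
        (fun (a : Arc (Bs B s) m') i => a.1 (Subalgebra.inclusion (le_Bs B s) (g i)))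
        (fun (a : Arc (Bs B s) m') (_ : Fin 1) => a.1 (uEl B s c -
          ∑ l, algebraMap k (Bs B s) (μ l) * Subalgebra.inclusion (le_Bs B s) (g l))) :=
      dominated_of_sq (Bs B s) m' (fun i => Subalgebra.inclusion (le_Bs B s) (g i))
        (fun _ => _) (fun i => hgm i) (fun _ => hμ) (blockgen g hggen μ)
    have h2 := rtdSet_pad _ _ hdom r h1
    -- shear back to (g, u)
    have h3 := rtdSet_gl _ (shearMat (Matrix.of fun (_ : Fin 1) l => μ l))
      (isUnit_det_shearMat _) r h2
    have h3' : RtdSet (fun (a : Arc (Bs B s) m') =>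
        Fin.append (fun i => a.1 (Subalgebra.inclusion (le_Bs B s) (g i)))
          (fun _ : Fin 1 => a.1 (uEl B s c))) r := by
      convert h3 using 2
      funext a
      rw [shearMat_mulVec]
      congr 1
      funext i
      simp only [map_sub, map_sum, map_mul, arc_algebraMap, Pi.add_apply, Matrix.mulVec,
        dotProduct, Matrix.map_apply, Matrix.of_apply]
      ring
    -- conclude with the presentation (g, u) of B[s⁻¹] inside m'
    refine ⟨N + 1, Fin.append (fun i => Subalgebra.inclusion (le_Bs B s) (g i))
      (fun _ => uEl B s c), ?_, ugen g hggen, ?_⟩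
    · intro i
      induction i using Fin.addCases with
      | left j => simpa [Fin.append_left] using hgm j
      | right j => simpa [Fin.append_right] using humem
    · convert h3' using 1
      funext a
      exact append_arc _ _ a

end Summit.ResolutionOfSingularities.ResolutionOfSingularities.Cruxes.RtdLocal.CotangentShadow

/-- **The crux `RtdLocal` of route RisoStrata (stmt-ResolutionOfSingularities-18840), by the
cotangent-shadow line.** -/
theorem Summit.ResolutionOfSingularities.ResolutionOfSingularities.Cruxes.RtdLocal.CotangentShadow.rtdLocal :
    Summit.ResolutionOfSingularities.ResolutionOfSingularities.Theses.RisoStrata.RtdLocal := by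
  intro p hp k _ _ _ K _ _ B s hs hs0 hFG Arc Rtd m' hm' r
  exact Summit.ResolutionOfSingularities.ResolutionOfSingularities.Cruxes.RtdLocal.CotangentShadow.rtdLocal_main
    B s hs hs0 hFG m' hm' r
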